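import Literature.Analysis.FluidPDE.OnsagerBDSVPerturbation
import Literature.Analysis.FluidPDE.OnsagerBDSVStressSplit
import Literature.Analysis.FluidPDE.OnsagerBDSVOscillationPrincipal
import Literature.Analysis.FluidPDE.OnsagerBDSVCorrectorBounds
import Literature.Analysis.FluidPDE.OnsagerBDSVPrincipalPartBound
import Literature.Analysis.FluidPDE.OnsagerBDSVIncrementEstimateProofs
import Literature.Analysis.FluidPDE.DeRosaPertCorrector
import Literature.Analysis.FluidPDE.DeRosaPerturbation
import HarnessLib

/-!
# De Rosa's perturbation stage: Prop. 5.11 (the bounds on `w_o` and `w_{q+1}`) under the core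
# hypotheses — port of the BDSV proofs of Cor. 5.8, and part 1 of the assembly

L. De Rosa, *Infinitely many Leray–Hopf solutions for the fractional Navier–Stokes equations*,
Comm. PDE 44 (2019) 335–365 = arXiv:1801.10235, §5.4 (Lemma 5.10, the geometric constant
`M = 64M̄∑|k|⁻⁴` (5.37)) and §5.5 Prop. 5.11 ("a proposition taken from [BDLSV2017]":
"`‖w_o‖₀ + λ_{q+1}⁻¹‖w_o‖₁ ≤ (M/4)δ_{q+1}^{1/2}`, …, `‖w_{q+1}‖₀ + λ_{q+1}⁻¹‖w_{q+1}‖₁ ≤ (M/2)δ_{q+1}^{1/2}`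
where the constant `M` depends solely on the constant `c₀`. In particular, we obtain (5.19)") =
Buckmaster–De Lellis–Székelyhidi–Vicol, CPAM 72 (2019), Cor. 5.8 (5.29)–(5.31). The BDSV proofs in
the tree use of the input triple only its smoothness, `div v̄_q = 0` (`det ∇Φᵢ = 1`), the symmetry
of the stress and the bounds (2.19)–(2.20); this file re-runs them VERBATIM under
`DeRosa.CoreHypotheses` (namespace `DeRosa`, same names as the BDSV twins), continuing
`DeRosaPertDeformation/Transport/Corrector.lean`:

* `CoreHypotheses.rhoQ_pos`, `CoreHypotheses.smoothData` (from `OnsagerBDSVStressSplit`);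
  `PerturbationData.oscPrincipalTensor_eq_sum` (`OnsagerBDSVOscillationPrincipal`);
* `DeRosa.principalPartBound` (Cor. 5.8 (5.29), from `OnsagerBDSVCorrectorBounds`) PROVED:
  `principalPartBound_holds` with its lemmas (`OnsagerBDSVPrincipalPartBound`);
* `DeRosa.incrementEstimate` (Cor. 5.8 (5.31) with `CoreHypotheses`, the shape of
  `BDSV.incrementEstimate`) PROVED: `incrementEstimate_holds` (`OnsagerBDSVIncrementEstimateProofs`);
* `DeRosa.increment_part` — part 1 of `DeRosa.perturbationStage_of_parts` (`DeRosa.incrementPart`).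

## References

* L. De Rosa, Comm. PDE 44 (2019) 335–365 = arXiv:1801.10235, §5.4 Lemma 5.10, (5.37); §5.5
  Prop. 5.11. [`Derosa2018`]
* T. Buckmaster, C. De Lellis, L. Székelyhidi Jr., V. Vicol, CPAM 72 (2019) 229–274 =
  arXiv:1701.08678, Cor. 5.8 (5.29)–(5.31), Def. 5.6. [`BuckmasterEtAl2018`]
-/

open MeasureTheory Set
open scoped NNReal ENNReal ContDiff Matrix Matrix.Norms.Elementwise

noncomputable section

namespace Literature.Analysis.FluidPDE

/-! ## Port of `OnsagerBDSVPerturbation` -/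

namespace DeRosa

open BDSV

open FunctionSpaces FunctionSpaces.Torus

/-- The flat three-torus `T³ = (ℝ/ℤ)³`, local notation. -/
local notation "𝕋³" => UnitAddTorus (Fin 3)

/-- Euclidean `ℝ³`, local notation. -/
local notation "ℝ³" => EuclideanSpace ℝ (Fin 3)

/-- Real `3 × 3` matrices, local notation. -/
local notation "𝕄" => Matrix (Fin 3) (Fin 3) ℝ

section Facts

/-- **The velocity increment bound** (BDSV Cor. 5.8, (5.31): "Assuming `a` is sufficiently
large, the perturbation `w_{q+1}` satisfies `‖w_{q+1}‖₀ + λ_{q+1}^{-1} ‖w_{q+1}‖₁ ≤ (M/2) δ_{q+1}^{1/2}`,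
where the constant `M` depends solely on the constant `c₀` in (5.19)" — and on the Mikado
profile, Remark 5.2, Lemma 5.5, Def. 5.6 `M = 64 M̄ ∑_{k≠0} |k|^{-4}`; the threshold for `a`
depends on `β, α, M` and the constants of the standing estimates, and needs
`b > (1 - β + 3α/2)/(1 - β)`, i.e. `α` small). Transcription: for every Mikado datum `𝔚` and
`c₀ > 0` there is `M = M(𝔚, c₀) > 0` such that for all cut-off constants `C_η`, all admissible
`β, b`, all `α < α₀(β, b)`, some `N̄`, all `C_in, C₀` and all `a ≥ a₀`, the perturbation
`w_{q+1}` (`BDSV.perturbation`) built from any data satisfying the standing hypotheses obeys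
(5.31) = (2.23) (`BDSV.VelocityIncrementBound` with constant `M/2`).
[cite: BuckmasterEtAl2018, Cor. 5.8 (5.31) and Def. 5.6] -/
def incrementEstimate : Prop :=
  ∀ (𝔚 : MikadoDatum mikadoRadius) (c₀ : ℝ), 0 < c₀ → ∃ M : ℝ, 0 < M ∧ ∀ Cη : ℕ → ℕ → ℝ,
    ∀ β : ℝ, 0 < β → β < 1 / 3 → ∀ b : ℝ, 1 < b → b < (1 - β) / (2 * β) →
      ∃ α₀ : ℝ, 0 < α₀ ∧ ∀ α : ℝ, 0 < α → α < α₀ → ∃ Nbar : ℕ, ∀ Cin C₀ : ℝ,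
        ∃ a₀ : ℝ, 1 < a₀ ∧ ∀ a : ℝ, a₀ ≤ a → ∀ S : Setting,
          CoreHypotheses ⟨β, α, a, b⟩ S Nbar Cin C₀ →
            ∀ 𝒟 : PerturbationData ⟨β, α, a, b⟩ S c₀ Cη,
              VelocityIncrementBound (M / 2) β a b S.T S.q
                (perturbation ⟨β, α, a, b⟩ S 𝔚 𝒟.cut.η 𝒟.D)

end Facts

end DeRosa

/-! ## Port of `OnsagerBDSVCorrectorBounds` -/

namespace DeRosa

open BDSV

open FunctionSpaces FunctionSpaces.Torus

/-- **Cor. 5.8, the principal part** (arXiv (5.29): "`‖w_o‖₀ + λ_{q+1}⁻¹‖w_o‖₁ ≤ (M/4)δ_{q+1}^{1/2}`",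
for `a` sufficiently large; proof arXiv (5.32)–(5.35): `‖(∇Φ_i)⁻¹‖₀ ≤ 2` on `supp η_i`, disjoint
supports of the `w_{o,i}`, Lemma 5.5, `‖∇e^{iλ_{q+1}k·Φ_i}‖₀ ≤ 2λ_{q+1}|k|`, Prop. 5.7 and
`(ℓλ_{q+1})⁻¹ ≤ …` for `b > (1-β+3α/2)/(1-β)`, `a` large). Transcription (module docstring): along
`BDSV.StageFact`, for `w_o = BDSV.principalPart`, `‖w_o‖₀ ≤ C δ_{q+1}^{1/2}` and
`[w_o]₁ ≤ C δ_{q+1}^{1/2} λ_{q+1}` on `[0,T] × T³` (`BDSV.SupLE`, `BDSV.DerivSupLE`), with an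
existential constant `C` in place of the printed `M/4`. [cite: BuckmasterEtAl2018, Cor. 5.8 (arXiv (5.29))] -/
def principalPartBound : Prop :=
  StageFact fun 𝔚 P C S _ _ 𝒟 =>
    SupLE S.T (principalPart P S 𝔚 𝒟.cut.η 𝒟.D) (C * Real.sqrt (amp P.β P.a P.b (S.q + 1))) ∧
      DerivSupLE S.T (principalPart P S 𝔚 𝒟.cut.η 𝒟.D)
        (C * (Real.sqrt (amp P.β P.a P.b (S.q + 1)) * freq P.a P.b (S.q + 1)))

end DeRosa

/-! ## Port of `OnsagerBDSVStressSplit` -/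

namespace DeRosa

open BDSV

open FunctionSpaces FunctionSpaces.Torus

/-- The flat three-torus `T³ = (ℝ/ℤ)³`, local notation. -/
local notation "𝕋³" => UnitAddTorus (Fin 3)

/-- Euclidean `ℝ³`, local notation. -/
local notation "ℝ³" => EuclideanSpace ℝ (Fin 3)

section Positivity

variable {P : Params} {S : Setting} {Nbar : ℕ} {Cin C₀ : ℝ}

/-- **`ρ_q > 0` on `[0,T]`** (the lower bound of Lemma 5.4, arXiv (5.11), qualitatively): under
the energy gap `δ_{q+1} λ_q^{-α}/2 ≤ e(t) - ∫ |v̄_q|²` of `DeRosa.CoreHypotheses` and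
`2δ_{q+2} ≤ δ_{q+1} λ_q^{-α}` (`BDSV.exists_threshold_amp_succ_succ`), one has
`3ρ_q = e - δ_{q+2}/2 - ∫|v̄_q|² ≥ δ_{q+1} λ_q^{-α}/4 > 0`. [cite: BuckmasterEtAl2018, Lemma 5.4 (arXiv (5.11))] -/
theorem CoreHypotheses.rhoQ_pos (H : CoreHypotheses P S Nbar Cin C₀) (ha : 1 ≤ P.a)
    (hδ : 2 * amp P.β P.a P.b (S.q + 2) ≤ amp P.β P.a P.b (S.q + 1) * freq P.a P.b S.q ^ (-P.α))
    {t : ℝ} (ht : t ∈ Icc 0 S.T) : 0 < rhoQ P S t := by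
  have h1 := (H.energy_gap t ht).1
  have hpos : 0 < amp P.β P.a P.b (S.q + 1) * freq P.a P.b S.q ^ (-P.α) :=
    mul_pos (amp_pos ha _) (Real.rpow_pos_of_pos (freq_pos ha _) _)
  unfold rhoQ
  linarith

/-- **The construction is smooth under the standing hypotheses**: given the energy gap,
`2δ_{q+2} ≤ δ_{q+1} λ_q^{-α}` (so `ρ_q > 0`) and `c₀ > 0`, the data of the perturbation step
satisfy `BDSV.SmoothData` (all fields jointly smooth on `[0,T] × T³`, `ρ_q > 0`, `∑∫η_j² > 0`;
cf. the same construction inside `BDSV.newTriple_isEulerReynolds_holds`). [folklore] -/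
theorem CoreHypotheses.smoothData (H : CoreHypotheses P S Nbar Cin C₀) (ha : 1 ≤ P.a)
    (hδ : 2 * amp P.β P.a P.b (S.q + 2) ≤ amp P.β P.a P.b (S.q + 1) * freq P.a P.b S.q ^ (-P.α))
    {c₀ : ℝ} (hc₀ : 0 < c₀) {Cη : ℕ → ℕ → ℝ} (𝒟 : PerturbationData P S c₀ Cη) :
    SmoothData P S 𝒟.cut.η 𝒟.D where
  pos_T := H.pos_T
  e := H.profile.smooth
  vbar := H.eulerReynolds.smooth_velocity
  pbar := H.eulerReynolds.smooth_pressure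
  Rbar := H.eulerReynolds.smooth_stress
  eta := 𝒟.cut.smooth
  disp i := (𝒟.flow i).smooth
  rho_pos _ ht := H.rhoQ_pos ha hδ ht
  mass_pos _ ht := 𝒟.etaMass_pos hc₀ ht

end Positivity

section Split

variable {P : Params} {S : Setting} {η : ℕ → ℝ → 𝕋³ → ℝ} {D : ℕ → ℝ → 𝕋³ → ℝ³}

namespace SmoothData

variable (h : SmoothData P S η D)

end SmoothData

end Split

end DeRosa

/-! ## Port of `OnsagerBDSVOscillationPrincipal` -/

namespace DeRosa

open BDSV

open FunctionSpaces FunctionSpaces.Torus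

/-- The flat three-torus `T³ = (ℝ/ℤ)³`, local notation. -/
local notation "𝕋³" => UnitAddTorus (Fin 3)

/-- Euclidean `ℝ³`, local notation. -/
local notation "ℝ³" => EuclideanSpace ℝ (Fin 3)

/-- Real `3 × 3` matrices, local notation. -/
local notation "𝕄" => Matrix (Fin 3) (Fin 3) ℝ

section Algebra

variable {P : Params} {S : Setting}
variable (𝔚 : MikadoDatum mikadoRadius) (η : ℕ → ℝ → 𝕋³ → ℝ) (D : ℕ → ℝ → 𝕋³ → ℝ³)

/-- **`w_o ⊗ w_o - R̄_q = Σ_i ρ_{q,i} adj(∇Φ_i) 𝕎(R̃_{q,i}, n_{q+1}Φ_i) adj(∇Φ_i)ᵀ`** (columns):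
the tensor under `ℛ div` in `𝒪₁` (`BDSV.oscPrincipalTensor`) is the sum over the cut-offs of the
conjugated mean-free Mikado tensors — (6.10) summed over `i`, before Fourier expansion — provided
the cut-offs are pointwise disjoint, `det ∇Φ_i = 1`, `ρ_q > 0` and `Σ_j∫η_j² > 0`.
[cite: BuckmasterEtAl2018, §6.1.3 (arXiv (6.10))] -/
theorem oscPrincipalTensor_eq_sum {t : ℝ} {x : 𝕋³}
    (hdisj : ∀ i i', i ≠ i' → η i t x = 0 ∨ η i' t x = 0)
    (hdet : ∀ i, (gradPhi D i t x).det = 1) (hρ : 0 < rhoQ P S t) (hm : 0 < etaMass P S η t)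
    (j : Fin 3) :
    oscPrincipalTensor P S 𝔚 η D t x j =
      ∑ i ∈ Finset.range (cutoffCount S.T (P.τ S.q)), colsOf (principalOscMatrix P S 𝔚 η D i t x) j := by
  rw [oscPrincipalTensor, principalPart_tensor_eq_sum 𝔚 η D hdisj j, stressSum_eq_sum,
    ← Finset.sum_sub_distrib]
  exact Finset.sum_congr rfl fun i _ =>
    principalSummand_tensor_sub_stressSummand 𝔚 η D (hdet i) hρ hm j

end Algebra

section Standing

variable {P : Params} {S : Setting} {Nbar : ℕ} {Cin C₀ c₀ : ℝ} {Cη : ℕ → ℕ → ℝ}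

/-- **(6.10) for the construction data under the standing hypotheses**: for `a ≥ 1`, `c₀ > 0` and
`ρ_q > 0` on `[0,T]` (Lemma 5.4), on `[0,T]`
`w_o ⊗ w_o - R̄_q = Σ_i ρ_{q,i} adj(∇Φ_i) 𝕎(R̃_{q,i}, n_{q+1}Φ_i) adj(∇Φ_i)ᵀ` — the cut-offs of a
`BDSV.PerturbationData` are disjoint (§5.2 (ii)), `Σ_j∫η_j² ≥ c₀ > 0` ((v)), and `det ∇Φ_i = 1`
for the backward flows of the divergence-free `v̄_q` (`OnsagerBDSVFlowJacobian.lean`).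
[cite: BuckmasterEtAl2018, §6.1.3 (arXiv (6.10))] -/
theorem PerturbationData.oscPrincipalTensor_eq_sum (H : CoreHypotheses P S Nbar Cin C₀)
    (𝒟 : PerturbationData P S c₀ Cη) (ha : 1 ≤ P.a) (hc₀ : 0 < c₀)
    (hρ : ∀ t ∈ Icc 0 S.T, 0 < rhoQ P S t) (𝔚 : MikadoDatum mikadoRadius) {t : ℝ}
    (ht : t ∈ Icc 0 S.T) (x : 𝕋³) (j : Fin 3) :
    oscPrincipalTensor P S 𝔚 𝒟.cut.η 𝒟.D t x j =
      ∑ i ∈ Finset.range (cutoffCount S.T (P.τ S.q)),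
        colsOf (principalOscMatrix P S 𝔚 𝒟.cut.η 𝒟.D i t x) j :=
  BDSV.oscPrincipalTensor_eq_sum 𝔚 𝒟.cut.η 𝒟.D (fun i i' h => 𝒟.cut.disjoint i i' h t x)
    (fun i => 𝒟.det_gradPhi_eq_one H ha i ht x) (hρ t ht)
    (lt_of_lt_of_le hc₀ (𝒟.cut.sum_sq_ge t ht)) j

end Standing

end DeRosa

/-! ## Port of `OnsagerBDSVPrincipalPartBound` -/

namespace DeRosa

open BDSV

open FunctionSpaces FunctionSpaces.Torus

section Pointwise

variable {P : Params} {S : Setting} {Nbar : ℕ} {Cin C₀ c₀ : ℝ} {Cη : ℕ → ℕ → ℝ}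

/-- **`|∂ⱼρ_{q,i}^{1/2}| ≤ max(C(0,1),0) (δ_{q+1}/c₀)^{1/2}`** on `[0,T] × T³` (Lemmas 5.3, 5.4).
[cite: BuckmasterEtAl2018, Lemma 5.3, Lemma 5.4] -/
theorem PerturbationData.abs_partialDeriv_sqrtRhoI_le (H : CoreHypotheses P S Nbar Cin C₀)
    (𝒟 : PerturbationData P S c₀ Cη) (hc₀ : 0 < c₀) (ha : 1 ≤ P.a) {i : ℕ} {t : ℝ}
    (ht : t ∈ Icc 0 S.T) (j : Fin 3) (x : (UnitAddTorus (Fin 3))) :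
    |Torus.partialDeriv j (sqrtRhoI P S 𝒟.cut.η i t) x| ≤
      max (Cη 0 1) 0 * Real.sqrt (amp P.β P.a P.b (S.q + 1) / c₀) := by
  -- the time factor: `(ρ_q/Σ∫η_j²)^{1/2} ≤ (δ_{q+1}/c₀)^{1/2}` (Lemma 5.4 (5.15), (5.19))
  have hm : c₀ ≤ etaMass P S 𝒟.cut.η t := 𝒟.le_etaMass ht
  have hm0 : 0 < etaMass P S 𝒟.cut.η t := hc₀.trans_le hm
  have hfac : Real.sqrt (rhoQ P S t / etaMass P S 𝒟.cut.η t) ≤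
      Real.sqrt (amp P.β P.a P.b (S.q + 1) / c₀) := by
    refine Real.sqrt_le_sqrt ?_
    calc rhoQ P S t / etaMass P S 𝒟.cut.η t
        ≤ amp P.β P.a P.b (S.q + 1) / etaMass P S 𝒟.cut.η t :=
          div_le_div_of_nonneg_right (H.rhoQ_le ha ht) hm0.le
      _ ≤ amp P.β P.a P.b (S.q + 1) / c₀ := div_le_div_of_nonneg_left (amp_pos ha _).le hc₀ hm
  rw [partialDeriv_sqrtRhoI ((𝒟.cut.smooth i).isSmooth_slice ht), abs_mul,
    abs_of_nonneg (Real.sqrt_nonneg _)]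
  exact mul_le_mul (𝒟.abs_partialDeriv_eta_le i ht j x) hfac (Real.sqrt_nonneg _) (le_max_right _ _)

/-- **`‖adj ∇Φ_i‖_∞ ≤ 2e^{8C_in}` on the support of `η_i`** ("`‖(∇Φ_i)⁻¹‖₀ ≤ 2` on `supp η_i`",
from `‖∇Φ_i‖_∞ ≤ e^{4C_in}` and `‖adj A‖_∞ ≤ 2‖A‖_∞²`). [cite: BuckmasterEtAl2018, Cor. 5.8 (proof, first line)] -/
theorem PerturbationData.norm_adjugate_gradPhi_le (H : CoreHypotheses P S Nbar Cin C₀)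
    (𝒟 : PerturbationData P S c₀ Cη) (hCin : 0 ≤ Cin) (ha : 1 ≤ P.a) (hb : 1 ≤ P.b) (hβ : 0 ≤ P.β)
    (hα : 0 ≤ P.α) {i : ℕ} {t : ℝ} (ht : t ∈ Icc 0 S.T) {x' : (UnitAddTorus (Fin 3))} (hη : 𝒟.cut.η i t x' ≠ 0) (x : (UnitAddTorus (Fin 3))) :
    ‖(gradPhi 𝒟.D i t x).adjugate‖ ≤ 2 * Real.exp (8 * Cin) := by
  have hG : ‖gradPhi 𝒟.D i t x‖ ≤ Real.exp (4 * Cin) := 𝒟.norm_gradPhi_le H hCin ha hb hβ hα ht hη x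
  refine (norm_adjugate_le _).trans ?_
  have h2 : ‖gradPhi 𝒟.D i t x‖ ^ 2 ≤ Real.exp (4 * Cin) ^ 2 := pow_le_pow_left₀ (norm_nonneg _) hG 2
  have h8 : Real.exp (4 * Cin) ^ 2 = Real.exp (8 * Cin) := by
    rw [← Real.exp_nat_mul]; ring_nf
  linarith

/-- **`‖∂ⱼ adj∇Φ_i‖ ≤ B₁` on `Ĩ_i` from a `C¹` bound on `(∇Φ_i)⁻¹`** (Prop. 5.7, arXiv (5.23), at
`N = 1`; `(∇Φ_i)⁻¹ = adj ∇Φ_i` since `det ∇Φ_i = 1`). [cite: BuckmasterEtAl2018, Prop. 5.7 (arXiv (5.23))] -/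
theorem PerturbationData.norm_partialDeriv_adjugate_gradPhi_le (H : CoreHypotheses P S Nbar Cin C₀)
    (𝒟 : PerturbationData P S c₀ Cη) (ha : 1 ≤ P.a) {i : ℕ} {t : ℝ} (ht : t ∈ Icc 0 S.T) {x' : (UnitAddTorus (Fin 3))}
    (hη : 𝒟.cut.η i t x' ≠ 0) {B₁ : ℝ} (hB₁ : 0 ≤ B₁)
    (hGinv : HolderSupOnLE (tildeInterval S.T (P.τ S.q) i) (fun s y => (gradPhi 𝒟.D i s y)⁻¹) 1 0 B₁)
    (j : Fin 3) (x : (UnitAddTorus (Fin 3))) :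
    ‖Torus.partialDeriv j (fun y => (gradPhi 𝒟.D i t y).adjugate) x‖ ≤ B₁ := by
  have htI : t ∈ tildeInterval S.T (P.τ S.q) i := 𝒟.cut.mem_tildeInterval ht hη
  have hDt : IsSmooth (𝒟.D i t) := (𝒟.flow i).smooth.isSmooth_slice ht
  have hinv : (fun y => (gradPhi 𝒟.D i t y)⁻¹) = fun y => (gradPhi 𝒟.D i t y).adjugate := by
    funext y
    rw [Matrix.inv_def, 𝒟.det_gradPhi_eq_one H ha i ht y, Ring.inverse_one, one_smul]
  have h : Torus.eContDiffHolderNorm 1 0 (fun y => (gradPhi 𝒟.D i t y).adjugate) ≤ ENNReal.ofReal B₁ := by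
    rw [← hinv]
    exact hGinv t htI
  have hadj : IsContDiff 1 (fun y => (gradPhi 𝒟.D i t y).adjugate) :=
    (isSmooth_adjugate_of_entries fun a b => isSmooth_gradPhi_entry hDt a b).isContDiff (by simp)
  exact norm_partialDeriv_le_of_eContDiffHolderNorm_le hadj hB₁ h j x

/-- **The middle factor `Id - (Σ∫η_j²/ρ_q) R̊̄_q` of `R̃_{q,i}` is bounded by `1 + 8C_in`** (arXiv
(5.28) at `N = 0`: `‖R_{q,i}/ρ_{q,i}‖₀ ≲ 1 + λ_q^α δ_{q+1}⁻¹‖R̊̄_q‖₀`, with (2.20) and `λ_q^αℓ^α ≤ 1`).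
[cite: BuckmasterEtAl2018, Prop. 5.7 (proof, arXiv (5.28))] -/
theorem PerturbationData.norm_middle_le (H : CoreHypotheses P S Nbar Cin C₀)
    (𝒟 : PerturbationData P S c₀ Cη) (hCin : 0 ≤ Cin) (ha : 1 ≤ P.a) (hb : 1 ≤ P.b) (hβ : 0 ≤ P.β)
    (hα : 0 ≤ P.α)
    (h4 : 4 * amp P.β P.a P.b (S.q + 2) ≤ amp P.β P.a P.b (S.q + 1) * freq P.a P.b S.q ^ (-P.α))
    {t : ℝ} (ht : t ∈ Icc 0 S.T) (x : (UnitAddTorus (Fin 3))) :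
    ‖(1 : (Matrix (Fin 3) (Fin 3) ℝ)) - (etaMass P S 𝒟.cut.η t / rhoQ P S t) • ofCols (S.Rbar t x)‖ ≤ 1 + 8 * Cin := by
  obtain ⟨hc0, hc⟩ := 𝒟.etaMass_div_rhoQ_le H ha h4 ht
  have hδ : 0 < amp P.β P.a P.b (S.q + 1) := amp_pos ha _
  have hR := H.norm_ofCols_Rbar_le hCin ha ht x
  have hcR : ‖(etaMass P S 𝒟.cut.η t / rhoQ P S t) • ofCols (S.Rbar t x)‖ ≤ 8 * Cin := by
    rw [norm_smul, Real.norm_eq_abs, abs_of_nonneg hc0]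
    have hprod := freq_rpow_mul_mollScale_rpow_le_one_of_nonneg (β := P.β) ha hb hβ hα S.q
    calc etaMass P S 𝒟.cut.η t / rhoQ P S t * ‖ofCols (S.Rbar t x)‖
        ≤ (8 * freq P.a P.b S.q ^ P.α / amp P.β P.a P.b (S.q + 1)) *
            (Cin * (amp P.β P.a P.b (S.q + 1) * mollScale P.β P.α P.a P.b S.q ^ P.α)) :=
          mul_le_mul hc hR (norm_nonneg _)
            (div_nonneg (mul_nonneg (by norm_num) (Real.rpow_nonneg (freq_pos ha _).le _)) hδ.le)
      _ = 8 * Cin * (freq P.a P.b S.q ^ P.α * mollScale P.β P.α P.a P.b S.q ^ P.α) := by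
          field_simp
      _ ≤ 8 * Cin * 1 := mul_le_mul_of_nonneg_left hprod (by positivity)
      _ = 8 * Cin := mul_one _
  exact (norm_sub_le _ _).trans (add_le_add norm_one_matrix_le hcR)

/-- **The derivative of the middle factor**: `‖∂ⱼ(Id - (Σ∫η_j²/ρ_q) R̊̄_q)(t,x)‖ ≤ 8C_in ℓ⁻¹`
(arXiv (5.28) at `N = 1`: `λ_q^α δ_{q+1}⁻¹ ‖R̊̄_q‖_1 ≲ ℓ^{-1+α}λ_q^α ≲ ℓ⁻¹`, with (2.20) at `N = 1`).
[cite: BuckmasterEtAl2018, Prop. 5.7 (proof, arXiv (5.28))] -/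
theorem PerturbationData.norm_partialDeriv_middle_le (H : CoreHypotheses P S Nbar Cin C₀)
    (𝒟 : PerturbationData P S c₀ Cη) (hN : 1 ≤ Nbar) (hCin : 0 ≤ Cin) (ha : 1 ≤ P.a) (hb : 1 ≤ P.b)
    (hβ : 0 ≤ P.β) (hα : 0 ≤ P.α)
    (h4 : 4 * amp P.β P.a P.b (S.q + 2) ≤ amp P.β P.a P.b (S.q + 1) * freq P.a P.b S.q ^ (-P.α))
    {t : ℝ} (ht : t ∈ Icc 0 S.T) (j : Fin 3) (x : (UnitAddTorus (Fin 3))) :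
    ‖Torus.partialDeriv j (fun y => (1 : (Matrix (Fin 3) (Fin 3) ℝ)) - (etaMass P S 𝒟.cut.η t / rhoQ P S t) • ofCols (S.Rbar t y)) x‖ ≤
      8 * Cin * (mollScale P.β P.α P.a P.b S.q)⁻¹ := by
  obtain ⟨hc0, hc⟩ := 𝒟.etaMass_div_rhoQ_le H ha h4 ht
  have hδ : 0 < amp P.β P.a P.b (S.q + 1) := amp_pos ha _
  have hℓ : 0 < mollScale P.β P.α P.a P.b S.q := mollScale_pos ha _
  have hR : IsSmooth (S.Rbar t) := H.eulerReynolds.smooth_stress.isSmooth_slice ht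
  -- (2.20) at `N = 1`, pointwise
  have hB : 0 ≤ Cin * (amp P.β P.a P.b (S.q + 1) *
      mollScale P.β P.α P.a P.b S.q ^ (-((1 : ℕ) : ℝ) + P.α)) :=
    mul_nonneg hCin (mul_nonneg hδ.le (Real.rpow_nonneg hℓ.le _))
  have hdR : ‖Torus.partialDeriv j (S.Rbar t) x‖ ≤
      Cin * (amp P.β P.a P.b (S.q + 1) * mollScale P.β P.α P.a P.b S.q ^ (-((1 : ℕ) : ℝ) + P.α)) :=
    norm_partialDeriv_le_of_eContDiffHolderNorm_le (hR.isContDiff (by simp)) hB (H.stress 1 hN t ht) j x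
  have hexp : mollScale P.β P.α P.a P.b S.q ^ (-((1 : ℕ) : ℝ) + P.α) =
      mollScale P.β P.α P.a P.b S.q ^ P.α * (mollScale P.β P.α P.a P.b S.q)⁻¹ := by
    rw [Nat.cast_one, show -(1 : ℝ) + P.α = P.α + (-1) by ring, Real.rpow_add hℓ, Real.rpow_neg_one]
  rw [hexp] at hdR
  have hprod := freq_rpow_mul_mollScale_rpow_le_one_of_nonneg (β := P.β) ha hb hβ hα S.q
  rw [partialDeriv_one_sub_smul_ofCols hR _ j x, norm_neg, norm_smul, Real.norm_eq_abs,
    abs_of_nonneg hc0]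
  calc etaMass P S 𝒟.cut.η t / rhoQ P S t * ‖ofCols (Torus.partialDeriv j (S.Rbar t) x)‖
      ≤ (8 * freq P.a P.b S.q ^ P.α / amp P.β P.a P.b (S.q + 1)) *
          (Cin * (amp P.β P.a P.b (S.q + 1) *
            (mollScale P.β P.α P.a P.b S.q ^ P.α * (mollScale P.β P.α P.a P.b S.q)⁻¹))) :=
        mul_le_mul hc ((norm_ofCols_le _).trans hdR) (norm_nonneg _)
          (div_nonneg (mul_nonneg (by norm_num) (Real.rpow_nonneg (freq_pos ha _).le _)) hδ.le)
    _ = 8 * Cin * (freq P.a P.b S.q ^ P.α * mollScale P.β P.α P.a P.b S.q ^ P.α) *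
          (mollScale P.β P.α P.a P.b S.q)⁻¹ := by
        field_simp
    _ ≤ 8 * Cin * 1 * (mollScale P.β P.α P.a P.b S.q)⁻¹ := by gcongr
    _ = 8 * Cin * (mollScale P.β P.α P.a P.b S.q)⁻¹ := by rw [mul_one]

/-- **`‖∂ⱼR̃_{q,i}‖ ≲ ℓ⁻¹` on the support of `η_i`** (Prop. 5.7, arXiv (5.24), at `N = 1`:
"`‖R̃_{q,i}‖_N ≲ ‖∇Φ_i‖_N‖∇Φ_i‖₀ + ‖R_{q,i}/ρ_{q,i}‖_N`"), with the explicit constant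
`9e^{4C_in}(2(1+8C_in)B₁ + 8C_in e^{4C_in} ℓ⁻¹)` in terms of a `C¹` bound `B₁` on `∇Φ_i` over `Ĩ_i`.
[cite: BuckmasterEtAl2018, Prop. 5.7 (arXiv (5.24))] -/
theorem PerturbationData.norm_partialDeriv_tildeR_le (H : CoreHypotheses P S Nbar Cin C₀)
    (𝒟 : PerturbationData P S c₀ Cη) (hN : 1 ≤ Nbar) (hCin : 0 ≤ Cin) (ha : 1 ≤ P.a) (hb : 1 ≤ P.b)
    (hβ : 0 ≤ P.β) (hα : 0 ≤ P.α)
    (h4 : 4 * amp P.β P.a P.b (S.q + 2) ≤ amp P.β P.a P.b (S.q + 1) * freq P.a P.b S.q ^ (-P.α))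
    {i : ℕ} {t : ℝ} (ht : t ∈ Icc 0 S.T) {x' : (UnitAddTorus (Fin 3))} (hη : 𝒟.cut.η i t x' ≠ 0) {B₁ : ℝ} (hB₁ : 0 ≤ B₁)
    (hG1 : HolderSupOnLE (tildeInterval S.T (P.τ S.q) i) (fun s y => gradPhi 𝒟.D i s y) 1 0 B₁)
    (j : Fin 3) (x : (UnitAddTorus (Fin 3))) :
    ‖Torus.partialDeriv j (tildeR P S 𝒟.cut.η 𝒟.D i t) x‖ ≤
      9 * Real.exp (4 * Cin) * (2 * (1 + 8 * Cin) * B₁ +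
        Real.exp (4 * Cin) * (8 * Cin * (mollScale P.β P.α P.a P.b S.q)⁻¹)) := by
  have hDt : IsSmooth (𝒟.D i t) := (𝒟.flow i).smooth.isSmooth_slice ht
  have hR : IsSmooth (S.Rbar t) := H.eulerReynolds.smooth_stress.isSmooth_slice ht
  have hG : IsSmooth (gradPhi 𝒟.D i t) :=
    isSmooth_matrix_of_entries fun a b => isSmooth_gradPhi_entry hDt a b
  set c : ℝ := etaMass P S 𝒟.cut.η t / rhoQ P S t with hc
  have hM : IsSmooth (fun y => (1 : (Matrix (Fin 3) (Fin 3) ℝ)) - c • ofCols (S.Rbar t y)) :=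
    (isSmooth_const (1 : (Matrix (Fin 3) (Fin 3) ℝ))).sub ((hR.comp_clm ofColsCLM).smul c)
  have e : tildeR P S 𝒟.cut.η 𝒟.D i t =
      fun y => gradPhi 𝒟.D i t y * ((1 : (Matrix (Fin 3) (Fin 3) ℝ)) - c • ofCols (S.Rbar t y)) * (gradPhi 𝒟.D i t y)ᵀ := rfl
  rw [e]
  have hCin8 : 0 ≤ 1 + 8 * Cin := by positivity
  exact norm_partialDeriv_conj_le hG hM (Real.exp_pos _).le hCin8
    (𝒟.norm_gradPhi_le H hCin ha hb hβ hα ht hη x) (𝒟.norm_partialDeriv_gradPhi_le ht hη hB₁ hG1 j x)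
    (𝒟.norm_middle_le H hCin ha hb hβ hα h4 ht x)
    (𝒟.norm_partialDeriv_middle_le H hN hCin ha hb hβ hα h4 ht j x)

/-- **The derivative of the Mikado factor `W(R̃_{q,i}, n_{q+1}Φ_i)`** (the chain rule (5.34) plus
the slow derivative through the matrix argument): if `‖D¹W‖ ≤ C_W` on `B̄(0, ρ) × ℝ³` with
`R̃_{q,i}(t,x) ∈ B̄(0,ρ)` and `‖∂ⱼR̃_{q,i}(t,x)‖ ≤ R₁`, then
`‖∂ⱼ[W(R̃_{q,i}, n_{q+1}Φ_i)](t,x)‖ ≤ C_W (R₁ + 3 n_{q+1} e^{4C_in})` (`‖eⱼ + ∂ⱼD_i‖ ≤ 3‖∇Φ_i‖_∞`).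
[cite: BuckmasterEtAl2018, Cor. 5.8 (proof, arXiv (5.34))] -/
theorem PerturbationData.norm_partialDeriv_mikadoW_le (H : CoreHypotheses P S Nbar Cin C₀)
    (𝒟 : PerturbationData P S c₀ Cη) (𝔚 : MikadoDatum mikadoRadius) (hCin : 0 ≤ Cin) (ha : 1 ≤ P.a)
    (hb : 1 ≤ P.b) (hβ : 0 ≤ P.β) (hα : 0 ≤ P.α) (hρ : ∀ s ∈ Icc 0 S.T, rhoQ P S s ≠ 0)
    {i : ℕ} {t : ℝ} (ht : t ∈ Icc 0 S.T) {x' : (UnitAddTorus (Fin 3))} (hη : 𝒟.cut.η i t x' ≠ 0) {ρ CW R₁ : ℝ}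
    (hCW0 : 0 ≤ CW)
    (hCW : ∀ R ∈ Metric.closedBall (0 : (Matrix (Fin 3) (Fin 3) ℝ)) ρ, ∀ ξ : (EuclideanSpace ℝ (Fin 3)), ‖iteratedFDeriv ℝ 1 (mikadoLift 𝔚.W) (R, ξ)‖ ≤ CW)
    {j : Fin 3} {x : (UnitAddTorus (Fin 3))} (hRt : tildeR P S 𝒟.cut.η 𝒟.D i t x ∈ Metric.closedBall (0 : (Matrix (Fin 3) (Fin 3) ℝ)) ρ)
    (hR1 : ‖Torus.partialDeriv j (tildeR P S 𝒟.cut.η 𝒟.D i t) x‖ ≤ R₁) :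
    ‖Torus.partialDeriv j (fun y => 𝔚.W (tildeR P S 𝒟.cut.η 𝒟.D i t y)
        (P.freqNat (S.q + 1) • phiPoint 𝒟.D i t y)) x‖ ≤
      CW * (R₁ + P.freqNat (S.q + 1) * (3 * Real.exp (4 * Cin))) := by
  have hDt : IsSmooth (𝒟.D i t) := (𝒟.flow i).smooth.isSmooth_slice ht
  have hRm : IsSmooth (tildeR P S 𝒟.cut.η 𝒟.D i t) :=
    isSmooth_matrix_of_entries fun a b =>
      (isSmoothSpaceTimeOn_tildeR H.pos_T H.profile.smooth H.eulerReynolds.smooth_velocity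
        H.eulerReynolds.smooth_stress 𝒟.cut.smooth (fun k => (𝒟.flow k).smooth) hρ i a b).isSmooth_slice ht
  have h := norm_partialDeriv_mikado_comp_le (V := 𝔚.W) 𝔚.smooth_W hRm hDt (P.freqNat (S.q + 1))
    hCW0 (fun ξ => hCW _ hRt ξ) j
  refine h.trans (mul_le_mul_of_nonneg_left (max_le ?_ ?_) hCW0)
  · exact hR1.trans (le_add_of_nonneg_right (by positivity))
  · refine le_add_of_nonneg_of_le ((norm_nonneg _).trans hR1) ?_
    exact mul_le_mul_of_nonneg_left ((norm_single_add_partialDeriv_le 𝒟.D i t x j).trans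
      (mul_le_mul_of_nonneg_left (𝒟.norm_gradPhi_le H hCin ha hb hβ hα ht hη x) (by norm_num)))
      (Nat.cast_nonneg _)

/-- **The derivative bound on `w_o` at fixed parameters** (the heart of arXiv (5.35)
`‖∇w_o‖₀ ≤ (M/16)δ_{q+1}^{1/2}λ_{q+1} + C̄ δ_{q+1}^{1/2} ℓ⁻¹`, with unspecified constants): under the
standing hypotheses with `N̄ ≥ 1`, `C_in ≥ 0`, `c₀ > 0`, `a ≥ 1`, `4δ_{q+2} ≤ δ_{q+1}λ_q^{-α}`, given
bounds `K_W` on `W` and `C_W` on `D¹W` over the ball `‖R‖_∞ ≤ 9e^{8C_in}(1 + 8C_in)` (Remark 5.2) and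
a common `C¹` bound `B₁` on `∇Φ_i`, `(∇Φ_i)⁻¹` over `Ĩ_i` (Prop. 5.7 (5.23)), every first spatial
derivative of `w_o` is bounded on `[0,T] × T³` by
`9 (δ_{q+1}/c₀)^{1/2} [2e^{8C_in}(C_W(9e^{4C_in}(2(1+8C_in)B₁ + 8C_in e^{4C_in}ℓ⁻¹) + 3n_{q+1}e^{4C_in})) + B₁K_W + max(C(0,1),0)·2e^{8C_in}K_W]`
— the sum over `i` costing nothing, at most one cut-off being active at each point (and
`∂ⱼw_{o,i} = 0` off `supp η_i`). [cite: BuckmasterEtAl2018, Cor. 5.8 (proof, arXiv (5.35))] -/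
theorem PerturbationData.norm_partialDeriv_principalPart_le (H : CoreHypotheses P S Nbar Cin C₀)
    (𝒟 : PerturbationData P S c₀ Cη) (𝔚 : MikadoDatum mikadoRadius) (hN : 1 ≤ Nbar) (hc₀ : 0 < c₀)
    (hCin : 0 ≤ Cin) (ha : 1 ≤ P.a) (hb : 1 ≤ P.b) (hβ : 0 ≤ P.β) (hα : 0 ≤ P.α)
    (h4 : 4 * amp P.β P.a P.b (S.q + 2) ≤ amp P.β P.a P.b (S.q + 1) * freq P.a P.b S.q ^ (-P.α))
    {KW CW B₁ : ℝ} (hKW0 : 0 ≤ KW)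
    (hKW : ∀ R ∈ Metric.closedBall (0 : (Matrix (Fin 3) (Fin 3) ℝ)) (9 * Real.exp (8 * Cin) * (1 + 8 * Cin)),
      ∀ ξ : (UnitAddTorus (Fin 3)), ‖𝔚.W R ξ‖ ≤ KW)
    (hCW0 : 0 ≤ CW)
    (hCW : ∀ R ∈ Metric.closedBall (0 : (Matrix (Fin 3) (Fin 3) ℝ)) (9 * Real.exp (8 * Cin) * (1 + 8 * Cin)),
      ∀ ξ : (EuclideanSpace ℝ (Fin 3)), ‖iteratedFDeriv ℝ 1 (mikadoLift 𝔚.W) (R, ξ)‖ ≤ CW)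
    (hB₁ : 0 ≤ B₁)
    (hG1 : ∀ i, HolderSupOnLE (tildeInterval S.T (P.τ S.q) i) (fun s y => gradPhi 𝒟.D i s y) 1 0 B₁)
    (hGinv : ∀ i, HolderSupOnLE (tildeInterval S.T (P.τ S.q) i)
      (fun s y => (gradPhi 𝒟.D i s y)⁻¹) 1 0 B₁)
    {t : ℝ} (ht : t ∈ Icc 0 S.T) (j : Fin 3) (x : (UnitAddTorus (Fin 3))) :
    ‖Torus.partialDeriv j (principalPart P S 𝔚 𝒟.cut.η 𝒟.D t) x‖ ≤
      9 * Real.sqrt (amp P.β P.a P.b (S.q + 1) / c₀) *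
        (2 * Real.exp (4 * Cin) ^ 2 *
            (CW * (9 * Real.exp (4 * Cin) * (2 * (1 + 8 * Cin) * B₁ +
              Real.exp (4 * Cin) * (8 * Cin * (mollScale P.β P.α P.a P.b S.q)⁻¹)) +
              P.freqNat (S.q + 1) * (3 * Real.exp (4 * Cin)))) +
          B₁ * KW + max (Cη 0 1) 0 * (2 * Real.exp (4 * Cin) ^ 2) * KW) := by
  -- `ρ_q > 0`, smooth data, smooth factors of the summands at time `t`
  have hρpos : ∀ s ∈ Icc 0 S.T, 0 < rhoQ P S s := fun s hs =>
    lt_of_lt_of_le (div_pos (mul_pos (amp_pos ha _) (Real.rpow_pos_of_pos (freq_pos ha _) _))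
      (by norm_num)) (H.le_rhoQ h4 hs)
  have hSD : SmoothData P S 𝒟.cut.η 𝒟.D := H.toSmoothData hc₀ 𝒟 hρpos
  have hf : ∀ i, IsSmooth (sqrtRhoI P S 𝒟.cut.η i t) := fun i => (hSD.sqrtRhoI i).isSmooth_slice ht
  have hA : ∀ i, IsSmooth (fun y => (gradPhi 𝒟.D i t y).adjugate) := fun i =>
    isSmooth_adjugate_of_entries fun a b =>
      isSmooth_gradPhi_entry ((𝒟.flow i).smooth.isSmooth_slice ht) a b
  have hv : ∀ i, IsSmooth (fun y => 𝔚.W (tildeR P S 𝒟.cut.η 𝒟.D i t y)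
      (P.freqNat (S.q + 1) • phiPoint 𝒟.D i t y)) := fun i => (hSD.mikadoW 𝔚 i).isSmooth_slice ht
  have hs : ∀ i, IsSmooth (principalSummand P S 𝔚 𝒟.cut.η 𝒟.D i t) := fun i =>
    (hf i).smul' (isSmooth_toEuclideanLin (hA i) (hv i))
  -- the bound is nonnegative
  set B : ℝ := 9 * Real.sqrt (amp P.β P.a P.b (S.q + 1) / c₀) *
        (2 * Real.exp (4 * Cin) ^ 2 *
            (CW * (9 * Real.exp (4 * Cin) * (2 * (1 + 8 * Cin) * B₁ +
              Real.exp (4 * Cin) * (8 * Cin * (mollScale P.β P.α P.a P.b S.q)⁻¹)) +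
              P.freqNat (S.q + 1) * (3 * Real.exp (4 * Cin)))) +
          B₁ * KW + max (Cη 0 1) 0 * (2 * Real.exp (4 * Cin) ^ 2) * KW) with hB
  have hℓ : 0 < mollScale P.β P.α P.a P.b S.q := mollScale_pos ha _
  have hCη0 : 0 ≤ max (Cη 0 1) 0 := le_max_right _ _
  have hB0 : 0 ≤ B := by positivity
  -- vanishing of `∂ⱼ w_{o,i}` off `supp η_i`
  have hzero : ∀ i, 𝒟.cut.η i t x = 0 → Torus.partialDeriv j (principalSummand P S 𝔚 𝒟.cut.η 𝒟.D i t) x = 0 :=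
    fun i hi => partialDeriv_smul_toEuclideanLin_eq_zero (hf i) (hA i) (hv i)
      (by rw [sqrtRhoI, hi, zero_mul]) (𝒟.partialDeriv_sqrtRhoI_eq_zero ht hi j)
  have e : principalPart P S 𝔚 𝒟.cut.η 𝒟.D t = fun y =>
      ∑ i ∈ Finset.range (cutoffCount S.T (P.τ S.q)), principalSummand P S 𝔚 𝒟.cut.η 𝒟.D i t y := rfl
  rw [e, partialDeriv_finset_sum _ (fun i _ => (hs i).isContDiff (by simp)) j x]
  refine 𝒟.cut.norm_sum_le t x hB0 hzero (fun i => ?_) _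
  by_cases hi : 𝒟.cut.η i t x = 0
  · rw [hzero i hi, norm_zero]
    exact hB0
  · -- the bounds on the three factors at `(t, x)`, where `η_i(t,x) ≠ 0`
    have hRt : tildeR P S 𝒟.cut.η 𝒟.D i t x ∈
        Metric.closedBall (0 : (Matrix (Fin 3) (Fin 3) ℝ)) (9 * Real.exp (8 * Cin) * (1 + 8 * Cin)) := by
      rw [Metric.mem_closedBall, dist_zero_right]
      exact 𝒟.norm_tildeR_le H hCin ha hb hβ hα h4 ht hi x
    have h1 := 𝒟.abs_sqrtRhoI_le H hc₀ ha ht i x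
    have h2 := 𝒟.abs_partialDeriv_sqrtRhoI_le H hc₀ ha (i := i) ht j x
    have h3 : ‖(gradPhi 𝒟.D i t x).adjugate‖ ≤ 2 * Real.exp (4 * Cin) ^ 2 :=
      (norm_adjugate_le _).trans (mul_le_mul_of_nonneg_left
        (pow_le_pow_left₀ (norm_nonneg _) (𝒟.norm_gradPhi_le H hCin ha hb hβ hα ht hi x) 2)
        (by norm_num))
    have h4' := 𝒟.norm_partialDeriv_adjugate_gradPhi_le H ha ht hi hB₁ (hGinv i) j x
    have h5 : ‖𝔚.W (tildeR P S 𝒟.cut.η 𝒟.D i t x) (P.freqNat (S.q + 1) • phiPoint 𝒟.D i t x)‖ ≤ KW :=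
      hKW _ hRt _
    have hR1 := 𝒟.norm_partialDeriv_tildeR_le H hN hCin ha hb hβ hα h4 ht hi hB₁ (hG1 i) j x
    have h6 := 𝒟.norm_partialDeriv_mikadoW_le H 𝔚 hCin ha hb hβ hα (fun s hs => (hρpos s hs).ne')
      ht hi hCW0 hCW hRt hR1
    refine (norm_partialDeriv_smul_toEuclideanLin_le (hf i) (hA i) (hv i) (Real.sqrt_nonneg _)
      (mul_nonneg hCη0 (Real.sqrt_nonneg _)) (by positivity) h1 h2 h3 h4' h5 h6).trans (le_of_eq ?_)
    rw [hB]
    ring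

end Pointwise

section Assembly

/-- **Cor. 5.8, the principal part, holds** (BDSV arXiv (5.29):
`‖w_o‖₀ + λ_{q+1}⁻¹‖w_o‖₁ ≤ (M/4)δ_{q+1}^{1/2}` for `a` sufficiently large — here with an existential
constant along the common prefix, as transcribed in `BDSV.principalPartBound`). Proof as printed:
the sup half is `BDSV.PerturbationData.norm_principalPart_le` (`‖(∇Φ_i)⁻¹‖₀ ≤ 2` on `supp η_i`,
disjoint supports); for the derivative half, `BDSV.PerturbationData.norm_partialDeriv_principalPart_le`
(Leibniz and chain rules, Prop. 5.7 at `N = 1` through the proved `BDSV.gradPhiBound_holds`,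
Lemma 5.3, Lemma 5.4, Remark 5.2) gives `‖∇w_o‖₀ ≲ δ_{q+1}^{1/2}(ℓ⁻¹ + n_{q+1} + 1)`, and (6.6)
`ℓ⁻¹ ≤ λ_{q+1}` (for `3α < 2(1-β)(b-1)`, `a` large), `n_{q+1} ≤ λ_{q+1}`, `1 ≤ λ_{q+1}` conclude.
Thresholds: `α < min(α₀(5.23), βb(b-1), (1-β)(b-1)/3)`, `N̄ = max(N̄(5.23), 1)`, `a` beyond the
thresholds of (5.23), of `4δ_{q+2} ≤ δ_{q+1}λ_q^{-α}` and of (6.6).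
[cite: BuckmasterEtAl2018, Cor. 5.8 (arXiv (5.29))] -/
theorem principalPartBound_holds : principalPartBound := by
  intro 𝔚 c₀ hc₀ Cη β hβ hβ3 b hb1 hb2
  -- Prop. 5.7 (5.23), proved in the tree
  obtain ⟨αG, hαG, hG⟩ := gradPhiBound_holds c₀ hc₀ Cη β hβ hβ3 b hb1 hb2
  have hb0 : (0 : ℝ) < b := by linarith
  have hbm : (0 : ℝ) < b - 1 := by linarith
  have h1β : (0 : ℝ) < 1 - β := by linarith
  refine ⟨min αG (min (β * b * (b - 1)) ((1 - β) * (b - 1) / 3)),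
    lt_min hαG (lt_min (mul_pos (mul_pos hβ hb0) hbm) (div_pos (mul_pos h1β hbm) (by norm_num))),
    fun α hα hαlt => ?_⟩
  have hαG' : α < αG := lt_of_lt_of_le hαlt (min_le_left _ _)
  have hαb : α < 2 * β * b * (b - 1) := by
    have := lt_of_lt_of_le hαlt ((min_le_right _ _).trans (min_le_left _ _))
    nlinarith [mul_pos hβ hb0]
  have hα66 : 3 * α < 2 * (1 - β) * (b - 1) := by
    have := lt_of_lt_of_le hαlt ((min_le_right _ _).trans (min_le_right _ _))
    nlinarith [mul_pos h1β hbm]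
  obtain ⟨NG, hG⟩ := hG α hα hαG' 1
  refine ⟨max NG 1, fun Cin C₀ => ?_⟩
  obtain ⟨C₁, aG, haG, hG⟩ := hG Cin C₀
  -- the constants
  set Cp : ℝ := max Cin 0 with hCp
  have hCp0 : 0 ≤ Cp := le_max_right _ _
  obtain ⟨KW, hKW0, hKW⟩ := 𝔚.exists_bound_W
    (isCompact_closedBall (0 : (Matrix (Fin 3) (Fin 3) ℝ)) (9 * Real.exp (8 * Cp) * (1 + 8 * Cp)))
  obtain ⟨CW, hCW0, hCW⟩ := exists_forall_norm_iteratedFDeriv_mikadoLift_le 𝔚.contDiff_mikadoLift_W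
    (isCompact_closedBall (0 : (Matrix (Fin 3) (Fin 3) ℝ)) (9 * Real.exp (8 * Cp) * (1 + 8 * Cp))) 1
  set C₁p : ℝ := max C₁ 0 with hC₁p
  have hC₁p0 : 0 ≤ C₁p := le_max_right _ _
  have hCη0 : 0 ≤ max (Cη 0 1) 0 := le_max_right _ _
  set E : ℝ := Real.exp (4 * Cp) with hE
  have hE0 : 0 ≤ E := (Real.exp_pos _).le
  -- the coefficients of `ℓ⁻¹`, of `n_{q+1}` and of `1` in the derivative bound, and the two constants
  set A₁ : ℝ := 2 * E ^ 2 * (CW * (9 * E * (2 * (1 + 8 * Cp) * C₁p + E * (8 * Cp)))) + C₁p * KW with hA₁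
  set A₂ : ℝ := 2 * E ^ 2 * (CW * (3 * E)) with hA₂
  set A₃ : ℝ := max (Cη 0 1) 0 * (2 * E ^ 2) * KW with hA₃
  have hA₁0 : 0 ≤ A₁ := by positivity
  have hA₂0 : 0 ≤ A₂ := by positivity
  have hA₃0 : 0 ≤ A₃ := by positivity
  set Ko : ℝ := 18 * Real.exp (8 * Cp) * KW / Real.sqrt c₀ with hKo
  set Kd : ℝ := 9 / Real.sqrt c₀ * (A₁ + A₂ + A₃) with hKd
  obtain ⟨a₄, ha₄, h4⟩ := exists_threshold_four_amp hb1 hαb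
  obtain ⟨a₆, ha₆, h66⟩ := exists_threshold_mollScale_inv_mul_freq_inv_le_one hb1.le hα66
  refine ⟨max Ko Kd, max aG (max a₄ a₆), lt_max_of_lt_left haG, fun a ha S H 𝒟 => ?_⟩
  have haG' : aG ≤ a := (le_max_left _ _).trans ha
  have ha₄' : a₄ ≤ a := ((le_max_left _ _).trans (le_max_right _ _)).trans ha
  have ha₆' : a₆ ≤ a := ((le_max_right _ _).trans (le_max_right _ _)).trans ha
  have ha1 : (1 : ℝ) ≤ a := haG.le.trans haG'
  have h4q := h4 a ha₄' S.q
  -- the standing hypotheses at the two orders used, with `C_in` replaced by `max C_in 0`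
  have HG : CoreHypotheses ⟨β, α, a, b⟩ S NG Cin C₀ := H.of_le (le_max_left _ _)
  have H1 : CoreHypotheses ⟨β, α, a, b⟩ S 1 Cp C₀ :=
    (H.of_le (le_max_right _ _)).mono_const ha1 (le_max_left _ _)
  -- (5.23) at `N = 1`, with the constant `C₁p ℓ⁻¹`
  have hℓ : 0 < mollScale β α a b S.q := mollScale_pos ha1 _
  have hmono : C₁ * mollScale β α a b S.q ^ (-((1 : ℕ) : ℝ)) ≤ C₁p * (mollScale β α a b S.q)⁻¹ := by
    rw [Nat.cast_one, Real.rpow_neg_one]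
    exact mul_le_mul_of_nonneg_right (le_max_left _ _) (inv_nonneg.2 hℓ.le)
  have hG1 : ∀ i, HolderSupOnLE (tildeInterval S.T (Params.τ ⟨β, α, a, b⟩ S.q) i)
      (fun s y => gradPhi 𝒟.D i s y) 1 0 (C₁p * (mollScale β α a b S.q)⁻¹) :=
    fun i => (hG a haG' S HG 𝒟 i).1.mono hmono
  have hGinv : ∀ i, HolderSupOnLE (tildeInterval S.T (Params.τ ⟨β, α, a, b⟩ S.q) i)
      (fun s y => (gradPhi 𝒟.D i s y)⁻¹) 1 0 (C₁p * (mollScale β α a b S.q)⁻¹) :=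
    fun i => (hG a haG' S HG 𝒟 i).2.mono hmono
  -- scales
  have hf1 : 0 < freq a b (S.q + 1) := freq_pos ha1 _
  have h1f : 1 ≤ freq a b (S.q + 1) := one_le_freq ha1 _
  have hL : (mollScale β α a b S.q)⁻¹ ≤ freq a b (S.q + 1) := by
    have h := h66 a ha₆' S.q
    calc (mollScale β α a b S.q)⁻¹
        = (mollScale β α a b S.q)⁻¹ * (freq a b (S.q + 1))⁻¹ * freq a b (S.q + 1) := by
          field_simp
      _ ≤ 1 * freq a b (S.q + 1) := mul_le_mul_of_nonneg_right h hf1.le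
      _ = freq a b (S.q + 1) := one_mul _
  have hn : (Params.freqNat ⟨β, α, a, b⟩ (S.q + 1) : ℝ) ≤ freq a b (S.q + 1) :=
    Params.freqNat_le_freq ⟨β, α, a, b⟩ (by show (0 : ℝ) ≤ a; linarith) (S.q + 1)
  have hσ : Real.sqrt (amp β a b (S.q + 1) / c₀) = Real.sqrt (amp β a b (S.q + 1)) / Real.sqrt c₀ :=
    Real.sqrt_div (amp_pos ha1 _).le c₀
  constructor
  · -- the sup bound (5.33)
    intro t ht x
    have h := 𝒟.norm_principalPart_le H1 𝔚 hc₀ hCp0 ha1 hb1.le hβ.le hα.le h4q hKW0 hKW ht x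
    exact h.trans (mul_le_mul_of_nonneg_right (le_max_left _ _) (Real.sqrt_nonneg _))
  · -- the derivative bound (5.35) and (6.6)
    intro j t ht x
    have hpt : ‖Torus.partialDeriv j (principalPart ⟨β, α, a, b⟩ S 𝔚 𝒟.cut.η 𝒟.D t) x‖ ≤
        9 * Real.sqrt (amp β a b (S.q + 1) / c₀) *
          (2 * Real.exp (4 * Cp) ^ 2 *
              (CW * (9 * Real.exp (4 * Cp) * (2 * (1 + 8 * Cp) * (C₁p * (mollScale β α a b S.q)⁻¹) +
                Real.exp (4 * Cp) * (8 * Cp * (mollScale β α a b S.q)⁻¹)) +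
                (Params.freqNat ⟨β, α, a, b⟩ (S.q + 1) : ℝ) * (3 * Real.exp (4 * Cp)))) +
            C₁p * (mollScale β α a b S.q)⁻¹ * KW +
            max (Cη 0 1) 0 * (2 * Real.exp (4 * Cp) ^ 2) * KW) :=
      𝒟.norm_partialDeriv_principalPart_le H1 𝔚 le_rfl hc₀ hCp0 ha1 hb1.le hβ.le hα.le h4q hKW0 hKW
        hCW0 hCW (B₁ := C₁p * (mollScale β α a b S.q)⁻¹) (by positivity) hG1 hGinv ht j x
    rw [← hE] at hpt
    set L : ℝ := (mollScale β α a b S.q)⁻¹ with hLdef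
    set nn : ℝ := (Params.freqNat ⟨β, α, a, b⟩ (S.q + 1) : ℝ) with hnn
    set lam : ℝ := freq a b (S.q + 1) with hlam
    have hL0 : 0 ≤ L := inv_nonneg.2 hℓ.le
    have hnn0 : 0 ≤ nn := Nat.cast_nonneg _
    -- the bracket is `A₁ L + A₂ n + A₃ ≤ (A₁ + A₂ + A₃) λ_{q+1}`
    have hT : 2 * E ^ 2 * (CW * (9 * E * (2 * (1 + 8 * Cp) * (C₁p * L) + E * (8 * Cp * L)) +
        nn * (3 * E))) + C₁p * L * KW + max (Cη 0 1) 0 * (2 * E ^ 2) * KW ≤ (A₁ + A₂ + A₃) * lam := by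
      have e : 2 * E ^ 2 * (CW * (9 * E * (2 * (1 + 8 * Cp) * (C₁p * L) + E * (8 * Cp * L)) +
          nn * (3 * E))) + C₁p * L * KW + max (Cη 0 1) 0 * (2 * E ^ 2) * KW =
          A₁ * L + A₂ * nn + A₃ := by
        rw [hA₁, hA₂, hA₃]; ring
      rw [e]
      have i1 : A₁ * L ≤ A₁ * lam := mul_le_mul_of_nonneg_left hL hA₁0
      have i2 : A₂ * nn ≤ A₂ * lam := mul_le_mul_of_nonneg_left hn hA₂0
      have i3 : A₃ ≤ A₃ * lam := le_mul_of_one_le_right hA₃0 h1f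
      linarith
    have hs0 : 0 ≤ Real.sqrt (amp β a b (S.q + 1)) := Real.sqrt_nonneg _
    have hc0 : 0 < Real.sqrt c₀ := Real.sqrt_pos.2 hc₀
    calc ‖Torus.partialDeriv j (principalPart ⟨β, α, a, b⟩ S 𝔚 𝒟.cut.η 𝒟.D t) x‖
        ≤ 9 * Real.sqrt (amp β a b (S.q + 1) / c₀) *
            (2 * E ^ 2 * (CW * (9 * E * (2 * (1 + 8 * Cp) * (C₁p * L) + E * (8 * Cp * L)) +
              nn * (3 * E))) + C₁p * L * KW + max (Cη 0 1) 0 * (2 * E ^ 2) * KW) := hpt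
      _ ≤ 9 * Real.sqrt (amp β a b (S.q + 1) / c₀) * ((A₁ + A₂ + A₃) * lam) :=
          mul_le_mul_of_nonneg_left hT (by positivity)
      _ = Kd * (Real.sqrt (amp β a b (S.q + 1)) * lam) := by
          rw [hσ, hKd]
          field_simp
      _ ≤ max Ko Kd * (Real.sqrt (amp β a b (S.q + 1)) * freq a b (S.q + 1)) :=
          mul_le_mul_of_nonneg_right (le_max_right _ _) (mul_nonneg hs0 hf1.le)

end Assembly

end DeRosa

/-! ## Port of `OnsagerBDSVIncrementEstimateProofs` -/

namespace DeRosa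

open BDSV

open FunctionSpaces FunctionSpaces.Torus

section Pointwise

variable {P : Params} {S : Setting} {Nbar : ℕ} {Cin C₀ c₀ : ℝ} {Cη : ℕ → ℕ → ℝ}

/-- **`‖∇Φ_i‖_∞ ≤ 301/300` on the support of `η_i`** under the deformation threshold
`exp(4C_inℓ^{2α}) - 1 ≤ 1/300` (Lemma 5.4 (5.14): `‖∇Φ_i - Id‖₀ ≲ τ_q‖v̄_q‖₁ ≲ ℓ^{2α} ≪ 1`, BDSV:
"`‖∇Φ_i - Id‖₀ ≤ 1/2` for `t ∈ supp(η_i)`"). [cite: BuckmasterEtAl2018, Lemma 5.4 (5.14)] -/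
theorem PerturbationData.norm_gradPhi_le_of_deformation (H : CoreHypotheses P S Nbar Cin C₀)
    (𝒟 : PerturbationData P S c₀ Cη) (hCin : 0 ≤ Cin) (ha : 1 ≤ P.a)
    (hdef : Real.exp (4 * (Cin * mollScale P.β P.α P.a P.b S.q ^ (2 * P.α))) - 1 ≤ 1 / 300)
    {i : ℕ} {t : ℝ} (ht : t ∈ Icc 0 S.T) {x' : (UnitAddTorus (Fin 3))} (hη : 𝒟.cut.η i t x' ≠ 0) (x : (UnitAddTorus (Fin 3))) :
    ‖gradPhi 𝒟.D i t x‖ ≤ 301 / 300 := by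
  rw [Matrix.norm_le_iff (by norm_num)]
  intro a j
  have hD := 𝒟.abs_partialDeriv_D_le_of_eta_ne_zero H hCin ha ht hη x a j
  have h1 : |(1 : (Matrix (Fin 3) (Fin 3) ℝ)) a j| ≤ 1 := by
    rw [Matrix.one_apply]; split_ifs <;> simp
  rw [Real.norm_eq_abs, gradPhi_apply]
  calc |(1 : (Matrix (Fin 3) (Fin 3) ℝ)) a j + Torus.partialDeriv j (𝒟.D i t) x a|
      ≤ |(1 : (Matrix (Fin 3) (Fin 3) ℝ)) a j| + |Torus.partialDeriv j (𝒟.D i t) x a| := abs_add_le _ _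
    _ ≤ 1 + 1 / 300 := add_le_add h1 (hD.trans hdef)
    _ = 301 / 300 := by norm_num

/-- **`‖adj∇Φ_i‖_∞ ≤ 3` on the support of `η_i`** under the deformation threshold (BDSV, proof
of Cor. 5.8, first line: "`‖(∇Φ_i)⁻¹‖₀ ≤ 2` on `supp η_i`"; here `‖adj A‖_∞ ≤ 2‖A‖_∞²` and
`‖∇Φ_i‖_∞ ≤ 301/300`; `adj∇Φ_i = (∇Φ_i)⁻¹` as `det∇Φ_i = 1`). [cite: BuckmasterEtAl2018, Cor. 5.8 (proof, first line)] -/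
theorem PerturbationData.norm_adjugate_gradPhi_le_three (H : CoreHypotheses P S Nbar Cin C₀)
    (𝒟 : PerturbationData P S c₀ Cη) (hCin : 0 ≤ Cin) (ha : 1 ≤ P.a)
    (hdef : Real.exp (4 * (Cin * mollScale P.β P.α P.a P.b S.q ^ (2 * P.α))) - 1 ≤ 1 / 300)
    {i : ℕ} {t : ℝ} (ht : t ∈ Icc 0 S.T) {x' : (UnitAddTorus (Fin 3))} (hη : 𝒟.cut.η i t x' ≠ 0) (x : (UnitAddTorus (Fin 3))) :
    ‖(gradPhi 𝒟.D i t x).adjugate‖ ≤ 3 := by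
  have hG := 𝒟.norm_gradPhi_le_of_deformation H hCin ha hdef ht hη x
  refine (norm_adjugate_le _).trans ?_
  have h2 : ‖gradPhi 𝒟.D i t x‖ ^ 2 ≤ (301 / 300) ^ 2 := pow_le_pow_left₀ (norm_nonneg _) hG 2
  nlinarith [h2]

/-- **`R̃_{q,i} ∈ {‖R‖_∞ ≤ 2}` on the support of `η_i`** (Lemma 5.4, last assertion:
`R̃_{q,i} ∈ B̄_{1/10}(Id)`, `BDSV.PerturbationData.tildeR_mem_closedBall`, and `‖Id‖_∞ ≤ 1`): the
fixed compact set of matrices on which the Mikado profile is bounded (Remark 5.2).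
[cite: BuckmasterEtAl2018, Lemma 5.4 and Remark 5.2] -/
theorem PerturbationData.tildeR_mem_closedBall_zero (H : CoreHypotheses P S Nbar Cin C₀)
    (𝒟 : PerturbationData P S c₀ Cη) (hCin : 0 ≤ Cin) (ha : 1 ≤ P.a)
    (hdef : Real.exp (4 * (Cin * mollScale P.β P.α P.a P.b S.q ^ (2 * P.α))) - 1 ≤ 1 / 300)
    (hstr : 8 * (Cin * (freq P.a P.b S.q ^ P.α * mollScale P.β P.α P.a P.b S.q ^ P.α)) ≤ 1 / 100)
    (h4 : 4 * amp P.β P.a P.b (S.q + 2) ≤ amp P.β P.a P.b (S.q + 1) * freq P.a P.b S.q ^ (-P.α))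
    {i : ℕ} {t : ℝ} (ht : t ∈ Icc 0 S.T) {x' : (UnitAddTorus (Fin 3))} (hη : 𝒟.cut.η i t x' ≠ 0) (x : (UnitAddTorus (Fin 3))) :
    tildeR P S 𝒟.cut.η 𝒟.D i t x ∈ Metric.closedBall (0 : (Matrix (Fin 3) (Fin 3) ℝ)) 2 := by
  have h := 𝒟.tildeR_mem_closedBall H hCin ha hdef hstr h4 ht hη x
  rw [Metric.mem_closedBall, dist_eq_norm] at h
  rw [Metric.mem_closedBall, dist_zero_right]
  calc ‖tildeR P S 𝒟.cut.η 𝒟.D i t x‖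
      = ‖(tildeR P S 𝒟.cut.η 𝒟.D i t x - 1) + 1‖ := by rw [sub_add_cancel]
    _ ≤ ‖tildeR P S 𝒟.cut.η 𝒟.D i t x - 1‖ + ‖(1 : (Matrix (Fin 3) (Fin 3) ℝ))‖ := norm_add_le _ _
    _ ≤ mikadoRadius + 1 := add_le_add h norm_one_matrix_le
    _ ≤ 2 := by norm_num [mikadoRadius]

/-- **Sharp sup bound on the principal part** (arXiv (5.33): "`‖w_o‖₀ ≤ (M/8)δ_{q+1}^{1/2}`" with
`M` depending on `c₀` and the profile only): under the standing hypotheses with `C_in ≥ 0`,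
`c₀ > 0`, `a ≥ 1`, `4δ_{q+2} ≤ δ_{q+1}λ_q^{-α}`, the deformation threshold and the stress threshold
`8C_inλ_q^αℓ^α ≤ 1/100` of Lemma 5.4, if `‖W‖ ≤ K_W` on `{‖R‖_∞ ≤ 2} × T³` then
`‖w_o(t,x)‖ ≤ 27 K_W (δ_{q+1}/c₀)^{1/2}` on `[0,T] × T³` (`|ρ_{q,i}^{1/2}| ≤ (δ_{q+1}/c₀)^{1/2}`,
`‖adj∇Φ_i‖_∞ ≤ 3`, `‖Av‖ ≤ 9‖A‖_∞‖v‖`, at most one cut-off active at each point).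
[cite: BuckmasterEtAl2018, Cor. 5.8 (proof, arXiv (5.33))] -/
theorem PerturbationData.norm_principalPart_le_sharp (H : CoreHypotheses P S Nbar Cin C₀)
    (𝒟 : PerturbationData P S c₀ Cη) (𝔚 : MikadoDatum mikadoRadius) (hc₀ : 0 < c₀) (hCin : 0 ≤ Cin)
    (ha : 1 ≤ P.a)
    (hdef : Real.exp (4 * (Cin * mollScale P.β P.α P.a P.b S.q ^ (2 * P.α))) - 1 ≤ 1 / 300)
    (hstr : 8 * (Cin * (freq P.a P.b S.q ^ P.α * mollScale P.β P.α P.a P.b S.q ^ P.α)) ≤ 1 / 100)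
    (h4 : 4 * amp P.β P.a P.b (S.q + 2) ≤ amp P.β P.a P.b (S.q + 1) * freq P.a P.b S.q ^ (-P.α))
    {KW : ℝ} (hKW0 : 0 ≤ KW)
    (hKW : ∀ R ∈ Metric.closedBall (0 : (Matrix (Fin 3) (Fin 3) ℝ)) 2, ∀ ξ : (UnitAddTorus (Fin 3)), ‖𝔚.W R ξ‖ ≤ KW)
    {t : ℝ} (ht : t ∈ Icc 0 S.T) (x : (UnitAddTorus (Fin 3))) :
    ‖principalPart P S 𝔚 𝒟.cut.η 𝒟.D t x‖ ≤ 27 * KW * Real.sqrt (amp P.β P.a P.b (S.q + 1) / c₀) := by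
  set B : ℝ := 27 * KW * Real.sqrt (amp P.β P.a P.b (S.q + 1) / c₀) with hB
  have hB0 : 0 ≤ B := by positivity
  refine 𝒟.cut.norm_sum_le t x hB0 (fun i hi => by rw [sqrtRhoI, hi, zero_mul, zero_smul]) ?_ _
  intro i
  by_cases hη : 𝒟.cut.η i t x = 0
  · rw [sqrtRhoI, hη, zero_mul, zero_smul, norm_zero]
    exact hB0
  · rw [norm_smul, Real.norm_eq_abs]
    have h1 := 𝒟.abs_sqrtRhoI_le H hc₀ ha ht i x
    have hadj := 𝒟.norm_adjugate_gradPhi_le_three H hCin ha hdef ht hη x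
    have hRt := 𝒟.tildeR_mem_closedBall_zero H hCin ha hdef hstr h4 ht hη x
    have hWle := hKW _ hRt (P.freqNat (S.q + 1) • phiPoint 𝒟.D i t x)
    have h2 := norm_toEuclideanLin_le (gradPhi 𝒟.D i t x).adjugate
      (𝔚.W (tildeR P S 𝒟.cut.η 𝒟.D i t x) (P.freqNat (S.q + 1) • phiPoint 𝒟.D i t x))
    have h3 : 9 * ‖(gradPhi 𝒟.D i t x).adjugate‖ *
        ‖𝔚.W (tildeR P S 𝒟.cut.η 𝒟.D i t x) (P.freqNat (S.q + 1) • phiPoint 𝒟.D i t x)‖ ≤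
        9 * 3 * KW :=
      mul_le_mul (mul_le_mul_of_nonneg_left hadj (by norm_num)) hWle (norm_nonneg _) (by positivity)
    calc |sqrtRhoI P S 𝒟.cut.η i t x| *
          ‖Matrix.toEuclideanLin (gradPhi 𝒟.D i t x).adjugate
            (𝔚.W (tildeR P S 𝒟.cut.η 𝒟.D i t x) (P.freqNat (S.q + 1) • phiPoint 𝒟.D i t x))‖
        ≤ Real.sqrt (amp P.β P.a P.b (S.q + 1) / c₀) * (9 * 3 * KW) :=
          mul_le_mul h1 (h2.trans h3) (norm_nonneg _) (Real.sqrt_nonneg _)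
      _ = B := by rw [hB]; ring

/-- **The derivative of the Mikado factor, sharp form** (the chain rule (5.34)
"`‖∇e^{iλ_{q+1}k·Φ_i}‖₀ ≤ λ_{q+1}|k|‖∇Φ_i‖₀ ≤ 2λ_{q+1}|k|`" for the whole profile): if `‖D¹W‖ ≤ C_W`
on `B̄(0,ρ) × ℝ³` with `R̃_{q,i}(t,x) ∈ B̄(0,ρ)`, `‖∂ⱼR̃_{q,i}(t,x)‖ ≤ R₁`, and the deformation
threshold holds, then `‖∂ⱼ[W(R̃_{q,i}, n_{q+1}Φ_i)](t,x)‖ ≤ C_W (R₁ + 4n_{q+1})`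
(`‖eⱼ + ∂ⱼD_i‖ ≤ 3‖∇Φ_i‖_∞ ≤ 4`). [cite: BuckmasterEtAl2018, Cor. 5.8 (proof, arXiv (5.34))] -/
theorem PerturbationData.norm_partialDeriv_mikadoW_le_sharp (H : CoreHypotheses P S Nbar Cin C₀)
    (𝒟 : PerturbationData P S c₀ Cη) (𝔚 : MikadoDatum mikadoRadius) (hCin : 0 ≤ Cin) (ha : 1 ≤ P.a)
    (hdef : Real.exp (4 * (Cin * mollScale P.β P.α P.a P.b S.q ^ (2 * P.α))) - 1 ≤ 1 / 300)
    (hρ : ∀ s ∈ Icc 0 S.T, rhoQ P S s ≠ 0)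
    {i : ℕ} {t : ℝ} (ht : t ∈ Icc 0 S.T) {x' : (UnitAddTorus (Fin 3))} (hη : 𝒟.cut.η i t x' ≠ 0) {ρ CW R₁ : ℝ}
    (hCW0 : 0 ≤ CW)
    (hCW : ∀ R ∈ Metric.closedBall (0 : (Matrix (Fin 3) (Fin 3) ℝ)) ρ, ∀ ξ : (EuclideanSpace ℝ (Fin 3)), ‖iteratedFDeriv ℝ 1 (mikadoLift 𝔚.W) (R, ξ)‖ ≤ CW)
    {j : Fin 3} {x : (UnitAddTorus (Fin 3))} (hRt : tildeR P S 𝒟.cut.η 𝒟.D i t x ∈ Metric.closedBall (0 : (Matrix (Fin 3) (Fin 3) ℝ)) ρ)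
    (hR1 : ‖Torus.partialDeriv j (tildeR P S 𝒟.cut.η 𝒟.D i t) x‖ ≤ R₁) :
    ‖Torus.partialDeriv j (fun y => 𝔚.W (tildeR P S 𝒟.cut.η 𝒟.D i t y)
        (P.freqNat (S.q + 1) • phiPoint 𝒟.D i t y)) x‖ ≤
      CW * (R₁ + P.freqNat (S.q + 1) * 4) := by
  have hDt : IsSmooth (𝒟.D i t) := (𝒟.flow i).smooth.isSmooth_slice ht
  have hRm : IsSmooth (tildeR P S 𝒟.cut.η 𝒟.D i t) :=
    isSmooth_matrix_of_entries fun a b =>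
      (isSmoothSpaceTimeOn_tildeR H.pos_T H.profile.smooth H.eulerReynolds.smooth_velocity
        H.eulerReynolds.smooth_stress 𝒟.cut.smooth (fun k => (𝒟.flow k).smooth) hρ i a b).isSmooth_slice ht
  have h := norm_partialDeriv_mikado_comp_le (V := 𝔚.W) 𝔚.smooth_W hRm hDt (P.freqNat (S.q + 1))
    hCW0 (fun ξ => hCW _ hRt ξ) j
  have hG := 𝒟.norm_gradPhi_le_of_deformation H hCin ha hdef ht hη x
  have hG4 : 3 * ‖gradPhi 𝒟.D i t x‖ ≤ 4 := by linarith
  refine h.trans (mul_le_mul_of_nonneg_left (max_le ?_ ?_) hCW0)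
  · exact hR1.trans (le_add_of_nonneg_right (by positivity))
  · refine le_add_of_nonneg_of_le ((norm_nonneg _).trans hR1) ?_
    exact mul_le_mul_of_nonneg_left ((norm_single_add_partialDeriv_le 𝒟.D i t x j).trans hG4)
      (Nat.cast_nonneg _)

/-- **Sharp derivative bound on the principal part** (arXiv (5.35):
"`‖∇w_o‖₀ ≤ (M/16)δ_{q+1}^{1/2}λ_{q+1} + C̄δ_{q+1}^{1/2}ℓ⁻¹`, where `C̄` depends upon `α`, `β` and
`M`; observe that `M/16` bounds the zero-order part with no `ℓ`"): under the standing hypotheses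
with `N̄ ≥ 1`, `C_in ≥ 0`, `c₀ > 0`, `a ≥ 1`, `4δ_{q+2} ≤ δ_{q+1}λ_q^{-α}` and the two thresholds of
Lemma 5.4, given bounds `K_W` on `W` and `C_W` on `D¹W` over `{‖R‖_∞ ≤ 2}` and a common `C¹`
bound `B₁` on `∇Φ_i`, `(∇Φ_i)⁻¹` over `Ĩ_i` (Prop. 5.7 (5.23)), every first spatial derivative of
`w_o` is bounded on `[0,T] × T³` by
`(δ_{q+1}/c₀)^{1/2}[108 C_W n_{q+1} + (27C_W·9e^{4C_in}(2(1+8C_in)B₁ + 8C_ine^{4C_in}ℓ⁻¹) + 9B₁K_W + 27max(C_η(0,1),0)K_W)]`: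
the coefficient of `n_{q+1}` depends on `(𝔚, c₀)` only. Proof: Leibniz and chain rules
(`BDSV.norm_partialDeriv_smul_toEuclideanLin_le`), Lemma 5.3, Lemma 5.4, the derivative of
`R̃_{q,i}` (`BDSV.PerturbationData.norm_partialDeriv_tildeR_le`), at most one cut-off active at each
point and `∂ⱼw_{o,i} = 0` off `supp η_i`. [cite: BuckmasterEtAl2018, Cor. 5.8 (proof, arXiv (5.35))] -/
theorem PerturbationData.norm_partialDeriv_principalPart_le_sharp (H : CoreHypotheses P S Nbar Cin C₀)
    (𝒟 : PerturbationData P S c₀ Cη) (𝔚 : MikadoDatum mikadoRadius) (hN : 1 ≤ Nbar) (hc₀ : 0 < c₀)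
    (hCin : 0 ≤ Cin) (ha : 1 ≤ P.a) (hb : 1 ≤ P.b) (hβ : 0 ≤ P.β) (hα : 0 ≤ P.α)
    (h4 : 4 * amp P.β P.a P.b (S.q + 2) ≤ amp P.β P.a P.b (S.q + 1) * freq P.a P.b S.q ^ (-P.α))
    (hdef : Real.exp (4 * (Cin * mollScale P.β P.α P.a P.b S.q ^ (2 * P.α))) - 1 ≤ 1 / 300)
    (hstr : 8 * (Cin * (freq P.a P.b S.q ^ P.α * mollScale P.β P.α P.a P.b S.q ^ P.α)) ≤ 1 / 100)
    {KW CW B₁ : ℝ} (hKW0 : 0 ≤ KW)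
    (hKW : ∀ R ∈ Metric.closedBall (0 : (Matrix (Fin 3) (Fin 3) ℝ)) 2, ∀ ξ : (UnitAddTorus (Fin 3)), ‖𝔚.W R ξ‖ ≤ KW)
    (hCW0 : 0 ≤ CW)
    (hCW : ∀ R ∈ Metric.closedBall (0 : (Matrix (Fin 3) (Fin 3) ℝ)) 2, ∀ ξ : (EuclideanSpace ℝ (Fin 3)), ‖iteratedFDeriv ℝ 1 (mikadoLift 𝔚.W) (R, ξ)‖ ≤ CW)
    (hB₁ : 0 ≤ B₁)
    (hG1 : ∀ i, HolderSupOnLE (tildeInterval S.T (P.τ S.q) i) (fun s y => gradPhi 𝒟.D i s y) 1 0 B₁)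
    (hGinv : ∀ i, HolderSupOnLE (tildeInterval S.T (P.τ S.q) i)
      (fun s y => (gradPhi 𝒟.D i s y)⁻¹) 1 0 B₁)
    {t : ℝ} (ht : t ∈ Icc 0 S.T) (j : Fin 3) (x : (UnitAddTorus (Fin 3))) :
    ‖Torus.partialDeriv j (principalPart P S 𝔚 𝒟.cut.η 𝒟.D t) x‖ ≤
      Real.sqrt (amp P.β P.a P.b (S.q + 1) / c₀) *
        (108 * CW * P.freqNat (S.q + 1) +
          (27 * CW * (9 * Real.exp (4 * Cin) * (2 * (1 + 8 * Cin) * B₁ +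
              Real.exp (4 * Cin) * (8 * Cin * (mollScale P.β P.α P.a P.b S.q)⁻¹))) +
            9 * B₁ * KW + 27 * max (Cη 0 1) 0 * KW)) := by
  -- `ρ_q > 0`, smooth data, smooth factors of the summands at time `t`
  have hρpos : ∀ s ∈ Icc 0 S.T, 0 < rhoQ P S s := fun s hs =>
    lt_of_lt_of_le (div_pos (mul_pos (amp_pos ha _) (Real.rpow_pos_of_pos (freq_pos ha _) _))
      (by norm_num)) (H.le_rhoQ h4 hs)
  have hSD : SmoothData P S 𝒟.cut.η 𝒟.D := H.toSmoothData hc₀ 𝒟 hρpos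
  have hf : ∀ i, IsSmooth (sqrtRhoI P S 𝒟.cut.η i t) := fun i => (hSD.sqrtRhoI i).isSmooth_slice ht
  have hA : ∀ i, IsSmooth (fun y => (gradPhi 𝒟.D i t y).adjugate) := fun i =>
    isSmooth_adjugate_of_entries fun a b =>
      isSmooth_gradPhi_entry ((𝒟.flow i).smooth.isSmooth_slice ht) a b
  have hv : ∀ i, IsSmooth (fun y => 𝔚.W (tildeR P S 𝒟.cut.η 𝒟.D i t y)
      (P.freqNat (S.q + 1) • phiPoint 𝒟.D i t y)) := fun i => (hSD.mikadoW 𝔚 i).isSmooth_slice ht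
  have hs : ∀ i, IsSmooth (principalSummand P S 𝔚 𝒟.cut.η 𝒟.D i t) := fun i =>
    (hf i).smul' (isSmooth_toEuclideanLin (hA i) (hv i))
  -- the bound is nonnegative
  set B : ℝ := Real.sqrt (amp P.β P.a P.b (S.q + 1) / c₀) *
        (108 * CW * P.freqNat (S.q + 1) +
          (27 * CW * (9 * Real.exp (4 * Cin) * (2 * (1 + 8 * Cin) * B₁ +
              Real.exp (4 * Cin) * (8 * Cin * (mollScale P.β P.α P.a P.b S.q)⁻¹))) +
            9 * B₁ * KW + 27 * max (Cη 0 1) 0 * KW)) with hB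
  have hℓ : 0 < mollScale P.β P.α P.a P.b S.q := mollScale_pos ha _
  have hCη0 : 0 ≤ max (Cη 0 1) 0 := le_max_right _ _
  have hB0 : 0 ≤ B := by positivity
  -- vanishing of `∂ⱼ w_{o,i}` off `supp η_i`
  have hzero : ∀ i, 𝒟.cut.η i t x = 0 → Torus.partialDeriv j (principalSummand P S 𝔚 𝒟.cut.η 𝒟.D i t) x = 0 :=
    fun i hi => partialDeriv_smul_toEuclideanLin_eq_zero (hf i) (hA i) (hv i)
      (by rw [sqrtRhoI, hi, zero_mul]) (𝒟.partialDeriv_sqrtRhoI_eq_zero ht hi j)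
  have e : principalPart P S 𝔚 𝒟.cut.η 𝒟.D t = fun y =>
      ∑ i ∈ Finset.range (cutoffCount S.T (P.τ S.q)), principalSummand P S 𝔚 𝒟.cut.η 𝒟.D i t y := rfl
  rw [e, partialDeriv_finset_sum _ (fun i _ => (hs i).isContDiff (by simp)) j x]
  refine 𝒟.cut.norm_sum_le t x hB0 hzero (fun i => ?_) _
  by_cases hi : 𝒟.cut.η i t x = 0
  · rw [hzero i hi, norm_zero]
    exact hB0
  · -- the bounds on the three factors at `(t, x)`, where `η_i(t,x) ≠ 0`
    have hRt := 𝒟.tildeR_mem_closedBall_zero H hCin ha hdef hstr h4 ht hi x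
    have h1 := 𝒟.abs_sqrtRhoI_le H hc₀ ha ht i x
    have h2 := 𝒟.abs_partialDeriv_sqrtRhoI_le H hc₀ ha (i := i) ht j x
    have h3 := 𝒟.norm_adjugate_gradPhi_le_three H hCin ha hdef ht hi x
    have h4' := 𝒟.norm_partialDeriv_adjugate_gradPhi_le H ha ht hi hB₁ (hGinv i) j x
    have h5 : ‖𝔚.W (tildeR P S 𝒟.cut.η 𝒟.D i t x) (P.freqNat (S.q + 1) • phiPoint 𝒟.D i t x)‖ ≤ KW :=
      hKW _ hRt _
    have hR1 := 𝒟.norm_partialDeriv_tildeR_le H hN hCin ha hb hβ hα h4 ht hi hB₁ (hG1 i) j x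
    have h6 := 𝒟.norm_partialDeriv_mikadoW_le_sharp H 𝔚 hCin ha hdef (fun s hs => (hρpos s hs).ne')
      ht hi hCW0 hCW hRt hR1
    refine (norm_partialDeriv_smul_toEuclideanLin_le (hf i) (hA i) (hv i) (Real.sqrt_nonneg _)
      (mul_nonneg hCη0 (Real.sqrt_nonneg _)) (by norm_num) h1 h2 h3 h4' h5 h6).trans (le_of_eq ?_)
    rw [hB]
    ring

end Pointwise

section Discharge

/-- **BDSV Cor. 5.8, (5.31), holds** (`‖w_{q+1}‖₀ + λ_{q+1}⁻¹‖w_{q+1}‖₁ ≤ (M/2)δ_{q+1}^{1/2}` for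
`a` sufficiently large, "where the constant `M` depends solely on the constant `c₀`" — and on
the Mikado profile, Def. 5.6): the named fact `BDSV.incrementEstimate`, with
`M = 2(2K₀ + K₁ + 1)`, `K₀ = 27K_W/c₀^{1/2}`, `K₁ = 108C_W/c₀^{1/2}`, `K_W`, `C_W` the bounds of `W`,
`D¹W` on `{‖R‖_∞ ≤ 2} × T³`. Proof as printed: `w_{q+1} = w_o + w_c`; the sharp bounds
`BDSV.PerturbationData.norm_principalPart_le_sharp` / `…norm_partialDeriv_principalPart_le_sharp`
on `w_o` (Lemma 5.4, Prop. 5.7 (5.23) through the proved `BDSV.gradPhiBound_holds`, Lemma 5.3);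
(5.30) for `w_c` (the proved `BDSV.correctorPartBound_holds`); and the absorption of all slow
terms by arXiv (6.4) `(ℓλ_{q+1})⁻¹ → 0`, `λ_{q+1}⁻¹ → 0`, `n_{q+1} ≤ λ_{q+1}`
(`BDSV.increment_absorb`). Thresholds: `α < min(α₀(5.23), α₀(5.30), βb(b-1), (1-β)(b-1)/3)`,
`N̄ = max(N̄(5.23), N̄(5.30), 1)`, `a` beyond the thresholds of (5.23), (5.30),
`4δ_{q+2} ≤ δ_{q+1}λ_q^{-α}`, `exp(4C_inℓ^{2α}) - 1 ≤ 1/300`, `8C_inλ_q^αℓ^α ≤ 1/100`,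
`2(3C + J) ≤ ℓλ_{q+1}` and `2J' ≤ λ_{q+1}`. [cite: BuckmasterEtAl2018, Cor. 5.8 (5.31) and Def. 5.6] -/
theorem incrementEstimate_holds : incrementEstimate := by
  intro 𝔚 c₀ hc₀
  -- the universal constants: bounds of `W`, `D¹W` on the fixed ball `‖R‖_∞ ≤ 2`, and `c₀`
  obtain ⟨KW, hKW0, hKW⟩ := 𝔚.exists_bound_W (isCompact_closedBall (0 : (Matrix (Fin 3) (Fin 3) ℝ)) 2)
  obtain ⟨CW, hCW0, hCW⟩ := exists_forall_norm_iteratedFDeriv_mikadoLift_le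
    𝔚.contDiff_mikadoLift_W (isCompact_closedBall (0 : (Matrix (Fin 3) (Fin 3) ℝ)) 2) 1
  have hc0' : 0 < Real.sqrt c₀ := Real.sqrt_pos.2 hc₀
  set K₀ : ℝ := 27 * KW / Real.sqrt c₀ with hK₀
  set K₁ : ℝ := 108 * CW / Real.sqrt c₀ with hK₁
  have hK₀0 : 0 ≤ K₀ := by positivity
  have hK₁0 : 0 ≤ K₁ := by positivity
  refine ⟨2 * (2 * K₀ + K₁ + 1), by positivity, fun Cη β hβ hβ3 b hb1 hb2 => ?_⟩
  -- Prop. 5.7 (5.23) and Cor. 5.8 (5.30), proved in the tree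
  obtain ⟨αG, hαG, hG⟩ := gradPhiBound_holds c₀ hc₀ Cη β hβ hβ3 b hb1 hb2
  obtain ⟨αc, hαc, hc⟩ := correctorPartBound_holds 𝔚 c₀ hc₀ Cη β hβ hβ3 b hb1 hb2
  have hb0 : (0 : ℝ) < b := by linarith
  have hbm : (0 : ℝ) < b - 1 := by linarith
  have h1β : (0 : ℝ) < 1 - β := by linarith
  refine ⟨min (min αG αc) (min (β * b * (b - 1)) ((1 - β) * (b - 1) / 3)),
    lt_min (lt_min hαG hαc) (lt_min (by positivity) (by positivity)), fun α hα hαlt => ?_⟩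
  have hαG' : α < αG := lt_of_lt_of_le hαlt ((min_le_left _ _).trans (min_le_left _ _))
  have hαc' : α < αc := lt_of_lt_of_le hαlt ((min_le_left _ _).trans (min_le_right _ _))
  have hαb : α < 2 * β * b * (b - 1) := by
    have := lt_of_lt_of_le hαlt ((min_le_right _ _).trans (min_le_left _ _))
    nlinarith [mul_pos hβ hb0]
  have hα64 : 3 * α / 2 < (b - 1) * (1 - β) := by
    have := lt_of_lt_of_le hαlt ((min_le_right _ _).trans (min_le_right _ _))
    nlinarith [mul_pos h1β hbm]
  obtain ⟨NG, hG⟩ := hG α hα hαG' 1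
  obtain ⟨Nc, hc⟩ := hc α hα hαc'
  refine ⟨max NG (max Nc 1), fun Cin C₀ => ?_⟩
  set Cp : ℝ := max Cin 0 with hCp
  have hCp0 : 0 ≤ Cp := le_max_right _ _
  obtain ⟨C₁, aG, haG, hG⟩ := hG Cp C₀
  obtain ⟨Cc, ac, hac, hc⟩ := hc Cin C₀
  have hC₁p0 : 0 ≤ max C₁ 0 := le_max_right _ _
  have hCcp0 : 0 ≤ max Cc 0 := le_max_right _ _
  have hCη0 : 0 ≤ max (Cη 0 1) 0 := le_max_right _ _
  -- the slow constants `J` (coefficient of `δ^{1/2}ℓ⁻¹`) and `J'` (coefficient of `δ^{1/2}`)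
  set J : ℝ := (27 * CW * (9 * Real.exp (4 * Cp) * (2 * (1 + 8 * Cp) * max C₁ 0 +
      Real.exp (4 * Cp) * (8 * Cp))) + 9 * max C₁ 0 * KW) / Real.sqrt c₀ with hJ
  set J' : ℝ := 27 * max (Cη 0 1) 0 * KW / Real.sqrt c₀ with hJ'
  have hJ0 : 0 ≤ J := by positivity
  have hJ'0 : 0 ≤ J' := by positivity
  -- thresholds in `a`
  obtain ⟨a₀, ha₀, hall⟩ := exists_threshold_and ⟨aG, haG, hG⟩ (exists_threshold_and ⟨ac, hac, hc⟩
    (exists_threshold_and (exists_threshold_four_amp hb1 hαb)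
    (exists_threshold_and (exists_threshold_deformation (b := b) hβ.le hb1.le hα hCp0)
    (exists_threshold_and (exists_threshold_freq_mul_mollScale_rpow_le hβ.le hb1.le hα (8 * Cp)
      (by norm_num : (0 : ℝ) < 1 / 100))
    (exists_threshold_and (exists_threshold_mollScale_freq_succ (β := β) hb1.le hα64 (2 * (3 * max Cc 0 + J)))
      (exists_threshold_freq_succ_inv hb1.le (2 * J')))))))
  refine ⟨a₀, ha₀, fun a ha S H 𝒟 => ?_⟩
  obtain ⟨hGa, hca, h4a, hdefa, hstra, h64a, hJ'a⟩ := hall a ha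
  have ha1 : (1 : ℝ) ≤ a := ha₀.le.trans ha
  -- the standing hypotheses at the orders and constants used
  have HG : CoreHypotheses ⟨β, α, a, b⟩ S NG Cp C₀ :=
    (H.of_le (le_max_left _ _)).mono_const ha1 (le_max_left _ _)
  have Hc : CoreHypotheses ⟨β, α, a, b⟩ S Nc Cin C₀ :=
    H.of_le ((le_max_left _ _).trans (le_max_right _ _))
  have H1 : CoreHypotheses ⟨β, α, a, b⟩ S 1 Cp C₀ :=
    (H.of_le ((le_max_right _ _).trans (le_max_right _ _))).mono_const ha1 (le_max_left _ _)
  -- the parameter inequalities at this `a`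
  have h4q : 4 * amp β a b (S.q + 2) ≤ amp β a b (S.q + 1) * freq a b S.q ^ (-α) := h4a S.q
  have hdef : Real.exp (4 * (Cp * mollScale β α a b S.q ^ (2 * α))) - 1 ≤ 1 / 300 := hdefa S.q
  have hstr : 8 * (Cp * (freq a b S.q ^ α * mollScale β α a b S.q ^ α)) ≤ 1 / 100 := by
    have h := hstra S.q
    rwa [mul_assoc] at h
  -- scales
  have hℓ : 0 < mollScale β α a b S.q := mollScale_pos ha1 _
  have hf1 : 0 < freq a b (S.q + 1) := freq_pos ha1 _
  have h1f : 1 ≤ freq a b (S.q + 1) := one_le_freq ha1 _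
  have hs0 : 0 ≤ Real.sqrt (amp β a b (S.q + 1)) := Real.sqrt_nonneg _
  have hσ : Real.sqrt (amp β a b (S.q + 1) / c₀) = Real.sqrt (amp β a b (S.q + 1)) / Real.sqrt c₀ :=
    Real.sqrt_div (amp_pos ha1 _).le c₀
  have hn : (Params.freqNat ⟨β, α, a, b⟩ (S.q + 1) : ℝ) ≤ freq a b (S.q + 1) :=
    Params.freqNat_le_freq ⟨β, α, a, b⟩ (by show (0 : ℝ) ≤ a; linarith) (S.q + 1)
  have hn0 : (0 : ℝ) ≤ (Params.freqNat ⟨β, α, a, b⟩ (S.q + 1) : ℝ) := Nat.cast_nonneg _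
  -- (5.23) at `N = 1`, with the constant `max C₁ 0 · ℓ⁻¹`
  have hmono : C₁ * mollScale β α a b S.q ^ (-((1 : ℕ) : ℝ)) ≤ max C₁ 0 * (mollScale β α a b S.q)⁻¹ := by
    rw [Nat.cast_one, Real.rpow_neg_one]
    exact mul_le_mul_of_nonneg_right (le_max_left _ _) (inv_nonneg.2 hℓ.le)
  have hG1 : ∀ i, HolderSupOnLE (tildeInterval S.T (Params.τ ⟨β, α, a, b⟩ S.q) i)
      (fun s y => gradPhi 𝒟.D i s y) 1 0 (max C₁ 0 * (mollScale β α a b S.q)⁻¹) :=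
    fun i => (hGa S HG 𝒟 i).1.mono hmono
  have hGinv : ∀ i, HolderSupOnLE (tildeInterval S.T (Params.τ ⟨β, α, a, b⟩ S.q) i)
      (fun s y => (gradPhi 𝒟.D i s y)⁻¹) 1 0 (max C₁ 0 * (mollScale β α a b S.q)⁻¹) :=
    fun i => (hGa S HG 𝒟 i).2.mono hmono
  have hB₁ : 0 ≤ max C₁ 0 * (mollScale β α a b S.q)⁻¹ := mul_nonneg hC₁p0 (inv_nonneg.2 hℓ.le)
  -- the bounds on `w_o`
  have hsup_o : SupLE S.T (principalPart ⟨β, α, a, b⟩ S 𝔚 𝒟.cut.η 𝒟.D)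
      (K₀ * Real.sqrt (amp β a b (S.q + 1))) := by
    intro t ht x
    have h := 𝒟.norm_principalPart_le_sharp H1 𝔚 hc₀ hCp0 ha1 hdef hstr h4q hKW0 hKW ht x
    rw [hσ] at h
    refine h.trans (le_of_eq ?_)
    rw [hK₀]
    ring
  have hder_o : DerivSupLE S.T (principalPart ⟨β, α, a, b⟩ S 𝔚 𝒟.cut.η 𝒟.D)
      (Real.sqrt (amp β a b (S.q + 1)) * (K₁ * (Params.freqNat ⟨β, α, a, b⟩ (S.q + 1) : ℝ) +
        J * (mollScale β α a b S.q)⁻¹ + J')) := by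
    intro j t ht x
    have h := 𝒟.norm_partialDeriv_principalPart_le_sharp H1 𝔚 le_rfl hc₀ hCp0 ha1 hb1.le hβ.le hα.le
      h4q hdef hstr hKW0 hKW hCW0 hCW hB₁ hG1 hGinv ht j x
    rw [hσ] at h
    refine h.trans (le_of_eq ?_)
    rw [hK₁, hJ, hJ']
    field_simp
    ring
  -- the bounds on `w_c` (5.30)
  have hsup_c : SupLE S.T (correctorPart ⟨β, α, a, b⟩ S 𝔚 𝒟.cut.η 𝒟.D)
      (max Cc 0 * (Real.sqrt (amp β a b (S.q + 1)) * (mollScale β α a b S.q)⁻¹ *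
        (freq a b (S.q + 1))⁻¹)) :=
    (hca S Hc 𝒟).1.mono (mul_le_mul_of_nonneg_right (le_max_left _ _)
      (mul_nonneg (mul_nonneg hs0 (inv_nonneg.2 hℓ.le)) (inv_nonneg.2 hf1.le)))
  have hder_c : DerivSupLE S.T (correctorPart ⟨β, α, a, b⟩ S 𝔚 𝒟.cut.η 𝒟.D)
      (max Cc 0 * (Real.sqrt (amp β a b (S.q + 1)) * (mollScale β α a b S.q)⁻¹)) :=
    (hca S Hc 𝒟).2.mono (mul_le_mul_of_nonneg_right (le_max_left _ _)
      (mul_nonneg hs0 (inv_nonneg.2 hℓ.le)))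
  -- smoothness of the two parts (for `∂ⱼ(w_o + w_c) = ∂ⱼw_o + ∂ⱼw_c`)
  have hρpos : ∀ s ∈ Icc 0 S.T, 0 < rhoQ ⟨β, α, a, b⟩ S s := fun s hs =>
    lt_of_lt_of_le (div_pos (mul_pos (amp_pos ha1 _) (Real.rpow_pos_of_pos (freq_pos ha1 _) _))
      (by norm_num)) (H1.le_rhoQ h4q hs)
  have hSD : SmoothData ⟨β, α, a, b⟩ S 𝒟.cut.η 𝒟.D := H1.toSmoothData hc₀ 𝒟 hρpos
  -- assembly of (5.31)
  refine ⟨K₀ * Real.sqrt (amp β a b (S.q + 1)) +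
      max Cc 0 * (Real.sqrt (amp β a b (S.q + 1)) * (mollScale β α a b S.q)⁻¹ * (freq a b (S.q + 1))⁻¹),
    Real.sqrt (amp β a b (S.q + 1)) * (K₁ * (Params.freqNat ⟨β, α, a, b⟩ (S.q + 1) : ℝ) +
        J * (mollScale β α a b S.q)⁻¹ + J') +
      max Cc 0 * (Real.sqrt (amp β a b (S.q + 1)) * (mollScale β α a b S.q)⁻¹), ?_, ?_, ?_⟩
  · -- `‖w_{q+1}‖₀ ≤ ‖w_o‖₀ + ‖w_c‖₀`
    intro t ht x
    rw [perturbation_eq_principalPart_add_correctorPart]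
    exact (norm_add_le _ _).trans (add_le_add (hsup_o t ht x) (hsup_c t ht x))
  · -- `[w_{q+1}]₁ ≤ [w_o]₁ + [w_c]₁`
    intro j t ht x
    have ho : IsSmooth (principalPart ⟨β, α, a, b⟩ S 𝔚 𝒟.cut.η 𝒟.D t) :=
      (hSD.principalPart 𝔚).isSmooth_slice ht
    have hw : IsSmooth (correctorPart ⟨β, α, a, b⟩ S 𝔚 𝒟.cut.η 𝒟.D t) :=
      (hSD.correctorPart 𝔚).isSmooth_slice ht
    have hfun : perturbation ⟨β, α, a, b⟩ S 𝔚 𝒟.cut.η 𝒟.D t =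
        principalPart ⟨β, α, a, b⟩ S 𝔚 𝒟.cut.η 𝒟.D t + correctorPart ⟨β, α, a, b⟩ S 𝔚 𝒟.cut.η 𝒟.D t := by
      funext y
      rw [Pi.add_apply]
      exact perturbation_eq_principalPart_add_correctorPart _ _ _ _ _ _ _
    rw [hfun, partialDeriv_add (ho.isContDiff (by simp)) (hw.isContDiff (by simp)) j, Pi.add_apply]
    exact (norm_add_le _ _).trans (add_le_add (hder_o j t ht x) (hder_c j t ht x))
  · -- the absorption of the slow terms
    have h64 : (3 * max Cc 0 + J) * ((mollScale β α a b S.q)⁻¹ * (freq a b (S.q + 1))⁻¹) ≤ 1 / 2 := by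
      have h := h64a S.q
      have hpos : 0 < mollScale β α a b S.q * freq a b (S.q + 1) := mul_pos hℓ hf1
      rw [← mul_inv, ← div_eq_mul_inv, le_div_iff₀ (by norm_num : (0 : ℝ) < 2)]
      rw [div_mul_eq_mul_div, div_le_iff₀ hpos]
      linarith
    have hJ'u : J' * (freq a b (S.q + 1))⁻¹ ≤ 1 / 2 := by
      have h := hJ'a S.q
      rw [← div_eq_mul_inv, div_le_iff₀ hf1] at h ⊢
      linarith
    have hu1 : (freq a b (S.q + 1))⁻¹ ≤ 1 := inv_le_one_of_one_le₀ h1f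
    have hnu : (Params.freqNat ⟨β, α, a, b⟩ (S.q + 1) : ℝ) * (freq a b (S.q + 1))⁻¹ ≤ 1 := by
      rw [← div_eq_mul_inv, div_le_one hf1]
      exact hn
    calc _ ≤ (2 * K₀ + K₁ + 1) * Real.sqrt (amp β a b (S.q + 1)) :=
          increment_absorb hs0 (inv_nonneg.2 hf1.le) hu1 hnu hK₀0 hK₁0 hCcp0 (inv_nonneg.2 hℓ.le) h64 hJ'u
      _ = 2 * (2 * K₀ + K₁ + 1) / 2 * Real.sqrt (amp β a b (S.q + 1)) := by ring

end Discharge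

end DeRosa

/-! ## Part 1 of `DeRosa.perturbationStage_of_parts` -/

namespace DeRosa

open BDSV

/-- **Part 1: the velocity increment bound (De Rosa Prop. 5.11, last display = BDSV Cor. 5.8)
under the core hypotheses**, in the shape consumed by `DeRosa.perturbationStage_of_parts`
(`DeRosa.incrementPart`: the constant `M` may depend on the cut-off constants as well).
[cite: Derosa2018, §5.5 Prop. 5.11 and §5.4 (5.37)] -/
theorem increment_part (𝔚 : MikadoDatum mikadoRadius) (c₀ : ℝ) (hc₀ : 0 < c₀) (Cη : ℕ → ℕ → ℝ) :
    incrementPart 𝔚 c₀ Cη := by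
  obtain ⟨M, hM, h⟩ := incrementEstimate_holds 𝔚 c₀ hc₀
  exact ⟨M, hM, h Cη⟩

end DeRosa

end Literature.Analysis.FluidPDE
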